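import Literature.Computability.FineGrained.SparsifierTheta
import HarnessLib

/-!
# The sparsification algorithm as a stack program, III: the sunflower scan and the children

Family `fine-grained` (trunk T-CPLX-FINE), continuing `SparsifierTheta.lean`. At a node of the
recursion tree of `Reduce` (Impagliazzo–Paturi–Zane, JCSS 63 (2001), §2, lines 2–5), after
`Θ`, the family `M` (a word in register `acc`) is scanned for a weak sunflower in the loop order
of the source: for `j = 2, …, k` and `i = 1, …, j - 1`, for every clause `s` of size `j` and
every subset `H ⊆ s` of size `j - i` (enumerated by position masks, `masks`, `pick`), count the
clauses of size `j` containing `H`; at the first count reaching the threshold `θ_i` the node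
branches: the *petal child* `M ++ petals` and, on top of it, the *heart child* `M ++ [H]` are
pushed on the work-list `wl` (so that the leaves are produced in the order of
`Sparsification.run`). If nothing is found the node is a leaf and its family is emitted.

* `masks`, `pick` and their combinatorics; `lenTest`; `extractH` (the heart of a mask);
* `countPass` (the number of clauses of size `j` containing the heart, in unary);
* `buildChildren` (`petalPass`, `heartKid`) and `emitLeaf`;
* `tryMask`, `processS`, `scanLevel`, `scan` with their list-level models `findS`,
  `findLevel`, `findBranch` and `ACom.Runs` specifications.

## References

* R. Impagliazzo, R. Paturi, F. Zane, *Which problems have strongly exponential complexity?*,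
  J. Comput. Syst. Sci. 63 (2001) 512–530, §2 (algorithm `Reduce`).
-/

namespace Literature.Computability.FineGrained.Sparsifier

open _root_.Computability Complexity Complexity.ACom

/-! ### Position masks -/

/-- All Boolean lists of length `j` with exactly `h` entries `true`. [folklore] -/
def masks : ℕ → ℕ → List (List Bool)
  | 0, 0 => [[]]
  | 0, _ + 1 => []
  | j + 1, h => (masks j h).map (List.cons false) ++
      match h with
      | 0 => []
      | h' + 1 => (masks j h').map (List.cons true)

/-- Characterisation of `masks`. [folklore] -/
theorem mem_masks_iff : ∀ (j h : ℕ) (μ : List Bool),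
    μ ∈ masks j h ↔ μ.length = j ∧ μ.count true = h
  | 0, 0, μ => by cases μ <;> simp [masks]
  | 0, h + 1, μ => by
    cases μ <;> simp [masks]
  | j + 1, h, μ => by
    cases μ with
    | nil => cases h <;> simp [masks]
    | cons b μ =>
      cases h with
      | zero =>
        cases b <;> simp [masks, mem_masks_iff j 0 μ]
      | succ h' =>
        cases b <;> simp [masks, mem_masks_iff j (h' + 1) μ, mem_masks_iff j h' μ]

/-- The sub-list of `s` selected by the mask `μ` (positions with `true`). [folklore] -/
def pick : List Bool → List Lit → List Lit
  | true :: μ, l :: s => l :: pick μ s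
  | false :: μ, _ :: s => pick μ s
  | _, _ => []

/-- `pick` with an exhausted mask. [folklore] -/
@[simp] theorem pick_nil_left (s : List Lit) : pick [] s = [] := by cases s <;> rfl

/-- `pick` on an exhausted list. [folklore] -/
@[simp] theorem pick_nil_right (μ : List Bool) : pick μ [] = [] := by
  cases μ with
  | nil => rfl
  | cons b μ => cases b <;> rfl

/-- `pick` selects a sub-list. [folklore] -/
theorem pick_sublist : ∀ (μ : List Bool) (s : List Lit), (pick μ s).Sublist s
  | [], s => by simp
  | _ :: _, [] => by simp
  | true :: μ, l :: s => (pick_sublist μ s).cons_cons l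
  | false :: μ, l :: s => (pick_sublist μ s).cons l

/-- Members of `pick μ s` are members of `s`. [folklore] -/
theorem mem_of_mem_pick {μ : List Bool} {s : List Lit} {l : Lit} (h : l ∈ pick μ s) : l ∈ s :=
  (pick_sublist μ s).subset h

/-- The length of `pick` is the number of `true`s (for masks of the right length). [folklore] -/
theorem length_pick : ∀ (μ : List Bool) (s : List Lit), μ.length = s.length →
    (pick μ s).length = μ.count true
  | [], s, _ => by simp
  | b :: μ, [], h => by simp at h
  | true :: μ, l :: s, h => by
    simp only [pick, List.length_cons, List.count_cons_self, length_pick μ s (by simpa using h)]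
  | false :: μ, l :: s, h => by
    simp only [pick, length_pick μ s (by simpa using h), List.count_cons]
    simp

/-- Every sub-list is picked by its indicator mask. [folklore] -/
theorem exists_mask_of_sublist : ∀ {H s : List Lit}, H.Sublist s →
    ∃ μ : List Bool, μ.length = s.length ∧ pick μ s = H
  | _, _, List.Sublist.slnil => ⟨[], rfl, rfl⟩
  | _, _, List.Sublist.cons a h => by
    obtain ⟨μ, hμ, rfl⟩ := exists_mask_of_sublist h
    exact ⟨false :: μ, by simp [hμ], rfl⟩
  | _, _, List.Sublist.cons_cons a h => by
    obtain ⟨μ, hμ, rfl⟩ := exists_mask_of_sublist h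
    exact ⟨true :: μ, by simp [hμ], rfl⟩

/-! ### Testing the size of a clause -/

/-- `lenTest j A`: with a unary counter in `len`, run `A` iff the counter is exactly `j`; `len`
is emptied. [folklore] -/
def lenTest (j : ℕ) (A : Prog) : Prog :=
  atLeast K.len j (ifTop K.len fun o => match o with
    | none => A
    | some _ => skip) skip ;; clear K.len

/-- `lenTest` when the test succeeds (`A` must leave `len` empty). [folklore] -/
theorem runs_lenTest_eq {j : ℕ} {A : Prog} {R R' : Store} {B : ℕ} (hlen : R K.len = unary j)
    (hA : Runs A (Function.update R K.len []) R' B) (hR' : R' K.len = []) :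
    Runs (lenTest j A) R R' (B + 2 * j + 3) := by
  unfold lenTest
  have h1 : Runs (ifTop K.len fun o => match o with
      | none => A
      | some _ => skip) (Function.update R K.len ((R K.len).drop j)) R' (B + 2) := by
    have hk : Function.update R K.len ((R K.len).drop j) K.len = [] := by simp [hlen, unary]
    have := Runs.ifTop_nil (f := fun o => match o with
      | none => A
      | some _ => skip) hk (by
        have e : Function.update R K.len ((R K.len).drop j) = Function.update R K.len [] := by
          simp [hlen, unary]
        rw [e]; exact hA)
    exact this
  have h2 := Runs.atLeast_ge (B := skip) (by rw [hlen, length_unary]) h1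
  have h3 := runs_clear K.len R'
  rw [hR'] at h3
  simp only [List.length_nil, Nat.mul_zero, Nat.zero_add] at h3
  have : Function.update R' K.len [] = R' := by rw [← hR']; exact Function.update_eq_self _ _
  rw [this] at h3
  exact (h2.seq h3).of_eq rfl (by omega)

/-- `lenTest` when the test fails. [folklore] -/
theorem runs_lenTest_ne {j m : ℕ} {A : Prog} {R : Store} (hlen : R K.len = unary m) (hm : m ≠ j) :
    Runs (lenTest j A) R (Function.update R K.len []) (2 * j + 2 * m + 6) := by
  unfold lenTest
  rcases Nat.lt_or_gt_of_ne hm with hlt | hgt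
  · -- fewer than `j`: `atLeast` exhausts the counter
    have h1 : Runs skip (Function.update R K.len []) (Function.update R K.len []) 0 := Runs.skip _
    have h2 := Runs.atLeast_lt (A := ifTop K.len fun o => match o with
      | none => A
      | some _ => skip) (by rw [hlen, length_unary]; exact hlt) h1
    have h3 := runs_clear K.len (Function.update R K.len [])
    simp only [Function.update_self, List.length_nil, Nat.mul_zero, Nat.zero_add,
      Function.update_idem] at h3
    exact (h2.seq h3).mono (by omega)
  · -- more than `j`: the counter is not exhausted, `ifTop` sees a blank
    obtain ⟨e, he⟩ : ∃ e, m = j + (e + 1) := ⟨m - j - 1, by omega⟩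
    have hdrop : (R K.len).drop j = Γ'.blank :: unary e := by
      rw [hlen, he, unary, List.drop_replicate, show j + (e + 1) - j = e + 1 by omega,
        List.replicate_succ]
      rfl
    have hk : Function.update R K.len ((R K.len).drop j) K.len = Γ'.blank :: unary e := by
      simp [hdrop]
    have h1 : Runs (ifTop K.len fun o => match o with
        | none => A
        | some _ => skip) (Function.update R K.len ((R K.len).drop j))
        (Function.update R K.len ((R K.len).drop j)) 3 :=
      Runs.ifTop_cons hk (Runs.skip _)
    have h2 := Runs.atLeast_ge (B := skip) (by rw [hlen, length_unary]; omega) h1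
    have h3 := runs_clear K.len (Function.update R K.len ((R K.len).drop j))
    simp only [Function.update_self, Function.update_idem, hdrop, List.length_cons,
      length_unary] at h3
    rw [hdrop] at h2
    exact (h2.seq h3).mono (by omega)

/-! ### Extracting the heart of a mask -/

/-- Action of the extraction pass: consult the next mask bit; on `true` append the accumulated
literal (reversed, through `y`) and a comma to `hr`, otherwise discard it. [folklore] -/
def extractAct : Prog :=
  pop K.mask fun o => match o with
    | some (Γ'.bit true) => pour K.x K.y ;; pour K.y K.hr ;; push K.hr Γ'.comma
    | _ => clear K.x

/-- `extractH μ`: with a clause body `cbody s₀` in `s`, leave in `h` the body of `pick μ s₀`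
(`s` is preserved). Requires `mask = s2 = x = y = hr = h = []`. [folklore] -/
def extractH (μ : List Bool) : Prog :=
  pushList K.mask (μ.reverse.map Γ'.bit) ;; loop K.s (litPass K.s2 K.x extractAct) ;;
  clear K.mask ;; pour K.s2 K.s ;; pour K.hr K.h

/-- `pick` over a concatenation: the second part is picked by the rest of the mask. [folklore] -/
theorem pick_append : ∀ (μ : List Bool) (d r : List Lit),
    pick μ (d ++ r) = pick μ d ++ pick (μ.drop d.length) r
  | [], d, r => by simp
  | b :: μ, [], r => by simp
  | true :: μ, l :: d, r => by simp [pick, pick_append μ d r]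
  | false :: μ, l :: d, r => by simp [pick, pick_append μ d r]

/-- The body of a sub-clause is not longer. [folklore] -/
theorem length_cbody_le_of_sublist {c d : List Lit} (h : c.Sublist d) :
    (cbody c).length ≤ (cbody d).length := by
  induction h with
  | slnil => simp
  | cons a _ ih => simp only [cbody_cons, List.length_append, List.length_cons]; omega
  | cons_cons a _ ih => simp only [cbody_cons, List.length_append, List.length_cons]; omega

/-- Literals of a picked sub-clause obey the literal bound of the clause. [folklore] -/
theorem litBound_pick {μ : List Bool} {s : List Lit} {L : ℕ} (hL : ∀ l ∈ s, (litBody l).length ≤ L) :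
    ∀ l ∈ pick μ s, (litBody l).length ≤ L := fun l hl => hL l (mem_of_mem_pick hl)

/-- Cost of `extractH` for a mask of length `mu`. [folklore] -/
def cExtract (L kk mu : ℕ) : ℕ := 3 * mu + (10 * L + 8) * kk + 6 * ((L + 1) * kk) + 5

/-- **Specification of `extractH`.** [folklore] -/
theorem runs_extractH (μ : List Bool) (s₀ : List Lit) (L kk : ℕ)
    (hL : ∀ l ∈ s₀, (litBody l).length ≤ L) (hk : s₀.length ≤ kk) (T : Store)
    (hs : T K.s = cbody s₀) (hmask : T K.mask = []) (hs2 : T K.s2 = []) (hx : T K.x = [])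
    (hy : T K.y = []) (hhr : T K.hr = []) (hh : T K.h = []) :
    Runs (extractH μ) T (Function.update T K.h (cbody (pick μ s₀))) (cExtract L kk μ.length) := by
  unfold extractH
  set W := (L + 1) * kk with hW
  have hWs : (cbody s₀).length ≤ W :=
    (length_cbody_le hL).trans (by rw [hW]; exact Nat.mul_le_mul_left _ hk)
  -- load the mask
  have e1 := runs_pushList K.mask (μ.reverse.map Γ'.bit) T
  rw [hmask, List.append_nil, List.map_reverse, List.reverse_reverse, List.length_reverse,
    List.length_map] at e1
  rw [← List.map_reverse] at e1
  set T₁ := Function.update T K.mask (μ.map Γ'.bit) with hT₁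
  -- the extraction pass
  set St : List Lit → List Lit → Store := fun done rest =>
    Function.update (Function.update (Function.update (Function.update T K.s (cbody rest)) K.s2
      (cbody done).reverse) K.mask ((μ.drop done.length).map Γ'.bit)) K.hr
      (cbody (pick μ done)).reverse with hSt
  have hpass := runs_litPass (reg := K.s) (sv := K.s2) (ac := K.x) extractAct (by decide)
    (by decide) (by decide) St s₀ L (6 * L + 5)
    (fun done rest => by simp [hSt])
    (fun done rest => by simp [hSt, hx])
    (fun done l rest hfull hl => by
      unfold extractAct
      set P := litPre K.s K.s2 K.x (St done (l :: rest)) l rest with hP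
      have hPx : P K.x = (litBody l).reverse := by simp [hP, litPre, hSt, hx]
      have hPmask : P K.mask = (μ.drop done.length).map Γ'.bit := by simp [hP, litPre, hSt]
      have hPy : P K.y = [] := by simp [hP, litPre, hSt, hy]
      have hPhr : P K.hr = (cbody (pick μ done)).reverse := by simp [hP, litPre, hSt]
      have hfin : ∀ m' : List Bool, μ.drop done.length = m' →
          St (done ++ [l]) rest = Function.update (Function.update (Function.update P K.x [])
            K.mask ((m'.drop 1).map Γ'.bit)) K.hr (cbody (pick μ done ++ pick m' [l])).reverse := by
        intro m' hm'
        have hdrop : μ.drop (done.length + 1) = m'.drop 1 := by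
          rw [← List.drop_drop, hm']
        rw [hP]
        simp only [litPre, hSt, List.length_append, List.length_singleton, hdrop, pick_append,
          hm']
        funext r; cases r <;> simp [hx, cbody_append, cbody_cons]
      cases hm : μ.drop done.length with
      | nil =>
        have hk : P K.mask = [] := by rw [hPmask, hm]; rfl
        have ec := runs_clear K.x P
        rw [hPx, List.length_reverse] at ec
        refine (Runs.pop_nil hk ec).of_eq ?_ (by omega)
        rw [hfin [] hm]
        simp only [List.drop_nil, List.map_nil, pick_nil_left, List.append_nil]
        rw [← hPhr, ← hk]
        funext r; cases r <;> simp
      | cons b m' =>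
        have hk : P K.mask = Γ'.bit b :: m'.map Γ'.bit := by rw [hPmask, hm]; rfl
        cases b with
        | false =>
          have ec := runs_clear K.x (Function.update P K.mask (m'.map Γ'.bit))
          have hv : Function.update P K.mask (m'.map Γ'.bit) K.x = (litBody l).reverse := by
            simp [hPx]
          rw [hv, List.length_reverse] at ec
          refine (Runs.pop_cons hk ec).of_eq ?_ (by omega)
          rw [hfin _ hm]
          simp only [List.drop_succ_cons, List.drop_zero, pick, List.append_nil]
          rw [← hPhr]
          funext r; cases r <;> simp
        | true =>
          set Q := Function.update P K.mask (m'.map Γ'.bit) with hQ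
          have f1 := runs_pour (a := K.x) (b := K.y) (by decide) Q
          have hQx : Q K.x = (litBody l).reverse := by simp [hQ, hPx]
          have hQy : Q K.y = [] := by simp [hQ, hPy]
          rw [hQx, hQy, List.length_reverse, List.reverse_reverse, List.append_nil] at f1
          set Q₁ := Function.update (Function.update Q K.x []) K.y (litBody l) with hQ₁
          have f2 := runs_pour (a := K.y) (b := K.hr) (by decide) Q₁
          have hQ₁y : Q₁ K.y = litBody l := by simp [hQ₁]
          have hQ₁hr : Q₁ K.hr = (cbody (pick μ done)).reverse := by simp [hQ₁, hQ, hPhr]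
          rw [hQ₁y, hQ₁hr] at f2
          set Q₂ := Function.update (Function.update Q₁ K.y []) K.hr
            ((litBody l).reverse ++ (cbody (pick μ done)).reverse) with hQ₂
          have f3 := Runs.push K.hr Γ'.comma Q₂
          refine (Runs.pop_cons hk ((f1.seq (f2.seq f3)).of_eq ?_ le_rfl)).mono (by omega)
          rw [hfin _ hm, hQ₂, hQ₁, hQ]
          simp only [List.drop_succ_cons, List.drop_zero, pick, cbody_append,
            cbody_cons, cbody_nil, List.reverse_append, List.reverse_cons]
          funext r; cases r <;> simp [hPy])
    s₀ [] rfl hL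
  have hSt0 : St [] s₀ = T₁ := by
    funext r; cases r <;> simp [hSt, hT₁, hs, hs2, hhr]
  rw [hSt0, List.nil_append] at hpass
  set T₂ := St s₀ [] with hT₂
  -- clear the leftover mask, restore `s`, bring the heart in reading order
  have e3 := runs_clear K.mask T₂
  have hT₂mask : (T₂ K.mask).length ≤ μ.length := by
    simp only [hT₂, hSt]; simp
  set T₃ := Function.update T₂ K.mask [] with hT₃
  have e4 := runs_pour (a := K.s2) (b := K.s) (by decide) T₃
  have hT₃s2 : T₃ K.s2 = (cbody s₀).reverse := by simp [hT₃, hT₂, hSt]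
  have hT₃s : T₃ K.s = [] := by simp [hT₃, hT₂, hSt]
  rw [hT₃s2, hT₃s, List.length_reverse, List.reverse_reverse, List.append_nil] at e4
  set T₄ := Function.update (Function.update T₃ K.s2 []) K.s (cbody s₀) with hT₄
  have e5 := runs_pour (a := K.hr) (b := K.h) (by decide) T₄
  have hT₄hr : T₄ K.hr = (cbody (pick μ s₀)).reverse := by simp [hT₄, hT₃, hT₂, hSt]
  have hT₄h : T₄ K.h = [] := by simp [hT₄, hT₃, hT₂, hSt, hh]
  rw [hT₄hr, hT₄h, List.length_reverse, List.reverse_reverse, List.append_nil] at e5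
  have hpk : (cbody (pick μ s₀)).length ≤ W :=
    (length_cbody_le_of_sublist (pick_sublist μ s₀)).trans hWs
  have := e1.seq (hpass.seq (e3.seq (e4.seq e5)))
  refine this.of_eq ?_ ?_
  · rw [hT₄, hT₃, hT₂]
    simp only [hSt]
    funext r; cases r <;> simp [hs, hs2, hmask, hhr]
  · simp only [cExtract, ← hW]
    have : (4 * L + (6 * L + 5) + 3) * s₀.length ≤ (10 * L + 8) * kk := by
      rw [show 4 * L + (6 * L + 5) + 3 = 10 * L + 8 by ring]
      exact Nat.mul_le_mul_left _ hk
    omega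

/-! ### Counting the clauses of size `j` containing the heart -/

/-- The clauses of the sunflower: size `j` and containing the heart `H`. [folklore] -/
def selT (j : ℕ) (H t : List Lit) : Prop := t.length = j ∧ H ⊆ t

/-- `selT` is decidable (a conjunction of decidable predicates). [folklore] -/
instance (j : ℕ) (H t : List Lit) : Decidable (selT j H t) := inferInstanceAs (Decidable (_ ∧ _))

/-- Action of the counting pass on a clause `t`: bring it in reading order while counting its
literals, and if it has `j` of them test `H ⊆ t` and record a hit on `cnt`. [folklore] -/
def countAct (j : ℕ) : Prog :=
  pourCount K.cacc K.c K.len ;;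
  lenTest j (copyFwd K.h K.d K.y K.pt ;; subDC ;; pop K.fl2 (fun o => match o with
    | some _ => skip
    | none => push K.cnt Γ'.blank) ;; clear K.d) ;;
  clear K.c

/-- `countPass j`: with `acc = wFam M` and `h = cbody H`, leave in `cnt` the unary count of the
clauses `t ∈ M` with `|t| = j` and `H ⊆ t` (everything else restored). [folklore] -/
def countPass (j : ℕ) : Prog :=
  copyFwd K.acc K.mb K.y K.pt ;; loop K.mb (famPass K.j4 K.cacc (countAct j)) ;; clear K.j4

/-- Cost of `countAct`. [folklore] -/
def cCountAct (L kk : ℕ) : ℕ := 42 * (L + 1) * (kk + 1) * kk + 18 * ((L + 1) * kk) + 6 * kk + 25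

/-- Cost of `countPass` over `n` clauses. [folklore] -/
def cCount (L kk n : ℕ) : ℕ :=
  10 * (((L + 1) * kk + 2) * n) + 3 + ((4 * ((L + 1) * kk) + cCountAct L kk + 6) * n + 1) +
    (2 * (((L + 1) * kk + 2) * n) + 1)

/-- The registers that `countPass` needs empty besides the clean scratch registers. [folklore] -/
structure CountClean (T : Store) : Prop where
  (mb : T K.mb = []) (j4 : T K.j4 = []) (cacc : T K.cacc = []) (c : T K.c = [])
  (len : T K.len = []) (d : T K.d = []) (cnt : T K.cnt = []) (pt : T K.pt = [])

/-- **Specification of `countPass`.** [folklore] -/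
theorem runs_countPass (j : ℕ) (M : List (List Lit)) (H : List Lit) (L kk : ℕ) (hj : j ≤ kk)
    (hLM : ∀ t ∈ M, ∀ l ∈ t, (litBody l).length ≤ L) (hkM : ∀ t ∈ M, t.length ≤ kk)
    (hLH : ∀ l ∈ H, (litBody l).length ≤ L) (hkH : H.length ≤ kk) (T : Store)
    (hacc : T K.acc = wFam M) (hh : T K.h = cbody H) (hT : Clean T) (hT' : CountClean T) :
    Runs (countPass j) T (Function.update T K.cnt (unary (M.countP (selT j H))))
      (cCount L kk M.length) := by
  obtain ⟨hx, hx2, hy, hne, hfl, hfl2, hc2, hd2⟩ := hT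
  obtain ⟨hmb, hj4, hcacc, hc, hlen, hd, hcnt, hpt⟩ := hT'
  unfold countPass
  set W := (L + 1) * kk with hW
  have hWM : ∀ t ∈ M, (cbody t).length ≤ W := fun t ht =>
    (length_cbody_le (hLM t ht)).trans (by rw [hW]; exact Nat.mul_le_mul_left _ (hkM t ht))
  have hWH : (cbody H).length ≤ W :=
    (length_cbody_le hLH).trans (by rw [hW]; exact Nat.mul_le_mul_left _ hkH)
  -- the iteration copy
  have e0 := runs_copyFwd (a := K.acc) (b := K.mb) (t₁ := K.y) (t₂ := K.pt) (by decide)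
    (by decide) (by decide) (by decide) (by decide) (by decide) T hy hpt
  rw [hacc, hmb, List.append_nil] at e0
  set T₁ := Function.update T K.mb (wFam M) with hT₁
  -- the counting pass
  set St : List (List Lit) → List (List Lit) → Store := fun done rest =>
    Function.update (Function.update (Function.update T K.mb (wFam rest)) K.j4
      (wFam done).reverse) K.cnt (unary (done.countP (selT j H))) with hSt
  have hpass := runs_famPass (reg := K.mb) (sv := K.j4) (ca := K.cacc) (countAct j) (by decide)
    (by decide) (by decide) St M W (cCountAct L kk)
    (fun done rest => by simp [hSt])
    (fun done rest => by simp [hSt, hcacc])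
    (fun done t rest hfull htW => by
      have htmem : t ∈ M := by rw [← hfull]; simp
      have hLt := hLM t htmem
      have hkt := hkM t htmem
      unfold countAct
      set P := famPre K.mb K.j4 K.cacc (St done (t :: rest)) t rest with hP
      have hPv : ∀ r, r ≠ K.mb → r ≠ K.j4 → r ≠ K.cacc → r ≠ K.cnt → P r = T r := by
        intro r h1 h2 h3 h4
        simp [hP, famPre, hSt, Function.update_of_ne h1, Function.update_of_ne h2,
          Function.update_of_ne h3, Function.update_of_ne h4]
      -- bring `t` in reading order, counting its literals
      have e1 := runs_pourCount (src := K.cacc) (dst := K.c) (cn := K.len) (by decide) (by decide)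
        (by decide) P
      have hPcacc : P K.cacc = (cbody t).reverse := by simp [hP, famPre, hSt, hcacc]
      have hPc : P K.c = [] := by rw [hPv K.c (by decide) (by decide) (by decide) (by decide), hc]
      have hPlen : P K.len = [] := by
        rw [hPv K.len (by decide) (by decide) (by decide) (by decide), hlen]
      rw [hPcacc, hPc, hPlen, List.length_reverse, List.reverse_reverse, List.append_nil,
        List.append_nil, List.count_reverse, count_comma_cbody] at e1
      set P₁ := Function.update (Function.update (Function.update P K.cacc []) K.c (cbody t)) K.len
        (unary t.length) with hP₁
      have hP₁v : ∀ r, r ≠ K.mb → r ≠ K.j4 → r ≠ K.cacc → r ≠ K.cnt → r ≠ K.c → r ≠ K.len →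
          P₁ r = T r := by
        intro r h1 h2 h3 h4 h5 h6
        rw [hP₁, Function.update_of_ne h6, Function.update_of_ne h5, Function.update_of_ne h3,
          hPv r h1 h2 h3 h4]
      -- the size test and the inclusion test
      set P₃ := Function.update (Function.update P₁ K.len []) K.cnt
        ((if selT j H t then [Γ'.blank] else []) ++ P K.cnt) with hP₃
      have e2 : Runs (lenTest j (copyFwd K.h K.d K.y K.pt ;; subDC ;;
          pop K.fl2 (fun o => match o with
            | some _ => skip
            | none => push K.cnt Γ'.blank) ;; clear K.d)) P₁ P₃
          (10 * W + 42 * (L + 1) * (kk + 1) * kk + 2 * W + 6 * kk + 22) := by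
        by_cases htj : t.length = j
        · -- the body runs
          set Q := Function.update P₁ K.len [] with hQ
          have hQv : ∀ r, r ≠ K.mb → r ≠ K.j4 → r ≠ K.cacc → r ≠ K.cnt → r ≠ K.c → r ≠ K.len →
              Q r = T r := by
            intro r h1 h2 h3 h4 h5 h6
            rw [hQ, Function.update_of_ne h6, hP₁v r h1 h2 h3 h4 h5 h6]
          have f1 := runs_copyFwd (a := K.h) (b := K.d) (t₁ := K.y) (t₂ := K.pt) (by decide)
            (by decide) (by decide) (by decide) (by decide) (by decide) Q
            (by rw [hQv K.y (by decide) (by decide) (by decide) (by decide) (by decide) (by decide), hy])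
            (by rw [hQv K.pt (by decide) (by decide) (by decide) (by decide) (by decide) (by decide), hpt])
          have hQh : Q K.h = cbody H := by
            rw [hQv K.h (by decide) (by decide) (by decide) (by decide) (by decide) (by decide), hh]
          have hQd : Q K.d = [] := by
            rw [hQv K.d (by decide) (by decide) (by decide) (by decide) (by decide) (by decide), hd]
          rw [hQh, hQd, List.append_nil] at f1
          set Q₁ := Function.update Q K.d (cbody H) with hQ₁
          have hQ₁v : ∀ r, r ≠ K.mb → r ≠ K.j4 → r ≠ K.cacc → r ≠ K.cnt → r ≠ K.c → r ≠ K.len →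
              r ≠ K.d → Q₁ r = T r := by
            intro r h1 h2 h3 h4 h5 h6 h7
            rw [hQ₁, Function.update_of_ne h7, hQv r h1 h2 h3 h4 h5 h6]
          have f2 := runs_subDC H t L hLH hLt Q₁ (by simp [hQ₁]) (by simp [hQ₁, hQ, hP₁])
            (by rw [hQ₁v K.x (by decide) (by decide) (by decide) (by decide) (by decide) (by decide) (by decide), hx])
            (by rw [hQ₁v K.d2 (by decide) (by decide) (by decide) (by decide) (by decide) (by decide) (by decide), hd2])
            (by rw [hQ₁v K.fl2 (by decide) (by decide) (by decide) (by decide) (by decide) (by decide) (by decide), hfl2])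
            (by rw [hQ₁v K.c2 (by decide) (by decide) (by decide) (by decide) (by decide) (by decide) (by decide), hc2])
            (by rw [hQ₁v K.y (by decide) (by decide) (by decide) (by decide) (by decide) (by decide) (by decide), hy])
            (by rw [hQ₁v K.x2 (by decide) (by decide) (by decide) (by decide) (by decide) (by decide) (by decide), hx2])
            (by rw [hQ₁v K.ne (by decide) (by decide) (by decide) (by decide) (by decide) (by decide) (by decide), hne])
            (by rw [hQ₁v K.fl (by decide) (by decide) (by decide) (by decide) (by decide) (by decide) (by decide), hfl])
          set Q₂ := Function.update Q₁ K.fl2 (flag (¬ H ⊆ t)) with hQ₂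
          set Q₃ := Function.update (Function.update Q₂ K.fl2 []) K.cnt
            ((if H ⊆ t then [Γ'.blank] else []) ++ P K.cnt) with hQ₃
          have hQ₂cnt : Q₂ K.cnt = P K.cnt := by simp [hQ₂, hQ₁, hQ, hP₁]
          have f3 : Runs (pop K.fl2 fun o => match o with
              | some _ => skip
              | none => push K.cnt Γ'.blank) Q₂ Q₃ 3 := by
            by_cases hHt : H ⊆ t
            · have hk : Q₂ K.fl2 = [] := by simp [hQ₂, flag, hHt]
              refine (Runs.pop_nil hk (Runs.push' ?_)).mono (by norm_num)
              rw [hQ₃, if_pos hHt, ← hQ₂cnt]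
              have : Function.update Q₂ K.fl2 [] = Q₂ := by rw [← hk]; exact Function.update_eq_self _ _
              rw [this]; rfl
            · have hk : Q₂ K.fl2 = [Γ'.blank] := by simp [hQ₂, flag, hHt]
              refine (Runs.pop_cons hk ((Runs.skip _).of_eq ?_ le_rfl)).mono (by norm_num)
              rw [hQ₃, if_neg hHt, List.nil_append, ← hQ₂cnt]
              exact (Function.update_eq_self_iff.2 (by simp)).symm
          have f4 := runs_clear K.d Q₃
          have hQ₃d : Q₃ K.d = cbody H := by simp [hQ₃, hQ₂, hQ₁]
          rw [hQ₃d] at f4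
          have hbody := f1.seq (f2.seq (f3.seq f4))
          have hP₁len : P₁ K.len = unary j := by simp [hP₁, htj]
          refine (runs_lenTest_eq hP₁len (hbody.of_eq ?_ le_rfl) (by simp [hP₃, hQ])).mono ?_
          · rw [hP₃, hQ₃, hQ₂, hQ₁, hQ]
            have hsel : selT j H t ↔ H ⊆ t := by simp [selT, htj]
            by_cases hHt : H ⊆ t
            · rw [if_pos (hsel.2 hHt), if_pos hHt]
              funext r; cases r <;> simp [hfl2, hd,
                hP₁v K.fl2 (by decide) (by decide) (by decide) (by decide) (by decide) (by decide),
                hP₁v K.d (by decide) (by decide) (by decide) (by decide) (by decide) (by decide)]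
            · rw [if_neg (fun h => hHt (hsel.1 h)), if_neg hHt]
              funext r; cases r <;> simp [hfl2, hd,
                hP₁v K.fl2 (by decide) (by decide) (by decide) (by decide) (by decide) (by decide),
                hP₁v K.d (by decide) (by decide) (by decide) (by decide) (by decide) (by decide)]
          · have h2 : 42 * (L + 1) * (t.length + 1) * H.length ≤ 42 * (L + 1) * (kk + 1) * kk := by
              have := Nat.mul_le_mul (Nat.mul_le_mul_left (42 * (L + 1)) (Nat.succ_le_succ hkt)) hkH
              simpa [Nat.mul_assoc] using this
            omega
        · have hP₁len : P₁ K.len = unary t.length := by simp [hP₁]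
          refine (runs_lenTest_ne (A := copyFwd K.h K.d K.y K.pt ;; subDC ;;
            pop K.fl2 (fun o => match o with
              | some _ => skip
              | none => push K.cnt Γ'.blank) ;; clear K.d) hP₁len htj).of_eq ?_ (by omega)
          rw [hP₃, if_neg (fun h : selT j H t => htj h.1), List.nil_append]
          exact (Function.update_eq_self_iff.2 (by simp [hP₁])).symm
      -- clear `c`
      have e3 := runs_clear K.c P₃
      have hP₃c : P₃ K.c = cbody t := by simp [hP₃, hP₁]
      rw [hP₃c] at e3
      have := e1.seq (e2.seq e3)
      refine this.of_eq ?_ ?_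
      · rw [hP₃, hP₁, hP]
        simp only [famPre, hSt]
        by_cases hst : selT j H t
        · funext r; cases r <;> simp [hst, hcacc, hc, hlen, wFam_append, wFam_cons,
            List.countP_append, unary_succ]
        · funext r; cases r <;> simp [hst, hcacc, hc, hlen, wFam_append, wFam_cons,
            List.countP_append]
      · simp only [cCountAct, ← hW] at htW ⊢
        omega)
    M [] rfl hWM
  have hSt0 : St [] M = T₁ := by
    funext r; cases r <;> simp [hSt, hT₁, hj4, hcnt]
  rw [hSt0, List.nil_append] at hpass
  set T₂ := St M [] with hT₂
  have e4 := runs_clear K.j4 T₂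
  have hT₂j4 : T₂ K.j4 = (wFam M).reverse := by simp [hT₂, hSt]
  rw [hT₂j4, List.length_reverse] at e4
  have := e0.seq (hpass.seq e4)
  refine this.of_eq ?_ ?_
  · rw [hT₂]
    simp only [hSt]
    funext r; cases r <;> simp [hj4, hmb]
  · have hlen' : (wFam M).length ≤ (W + 2) * M.length := length_wFam_le hWM
    simp only [cCount, ← hW]
    omega

/-! ### The petal child -/

/-- The petals of the sunflower with heart `H` among the clauses of size `j`: `t ∖ H` for the
clauses `t` of size `j` containing `H`, in the order of `M`.
[cite: ImpagliazzoPaturiZaneJCSS2001, §2 (line 5 of Reduce, the petals)] -/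
def petalsL (j : ℕ) (H : List Lit) (M : List (List Lit)) : List (List Lit) :=
  (M.filter (selT j H)).map fun t => t.filter fun l => l ∉ H

/-- `dropLit`: remove from `kid` the literal just copied there (one symbol of `kid` per symbol
of `x`, and one more for its comma), emptying `x`. [folklore] -/
def dropLit : Prog := loop K.x (fun _ => pop K.kid fun _ => skip) ;; pop K.kid fun _ => skip

/-- Effect and cost of `dropLit`. [folklore] -/
theorem runs_dropLit (R : Store) (u v w : List Γ') (hx : R K.x = u) (hkid : R K.kid = v ++ w)
    (hlen : v.length = u.length + 1) :
    Runs dropLit R (Function.update (Function.update R K.x []) K.kid w) (4 * u.length + 3) := by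
  unfold dropLit
  have hloop := runs_loop_inv (k := K.x) (f := fun _ => pop K.kid fun _ => skip)
    (fun done rest => Function.update (Function.update R K.x rest) K.kid (v.drop done.length ++ w))
    (fun done rest => done.length + rest.length = u.length) 2
    (fun done rest _ => by simp)
    (fun done a rest hg => ⟨by simp at hg ⊢; omega, by
      have hlt : done.length < v.length := by simp at hg; omega
      obtain ⟨b, hb⟩ : ∃ b, v.drop done.length = b :: v.drop (done.length + 1) :=
        ⟨v[done.length], (List.drop_eq_getElem_cons hlt)⟩
      have hk : Function.update (Function.update (Function.update R K.x (a :: rest)) K.kid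
          (v.drop done.length ++ w)) K.x rest K.kid = b :: (v.drop (done.length + 1) ++ w) := by
        simp [hb]
      refine (Runs.pop_cons hk ((Runs.skip _).of_eq ?_ le_rfl)).of_eq rfl (by norm_num)
      funext r; cases r <;> simp⟩)
    u [] (by simp)
  have hS0 : Function.update (Function.update R K.x u) K.kid (v.drop ([] : List Γ').length ++ w)
      = R := by
    funext r; cases r <;> simp [hx, hkid]
  rw [hS0] at hloop
  simp only [List.append_nil, List.length_reverse] at hloop
  have hlast : v.drop u.length = [v[u.length]'(by omega)] := by
    rw [List.drop_eq_getElem_cons (by omega), List.drop_eq_nil_of_le (by omega)]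
  rw [hlast, List.singleton_append] at hloop
  have hk : Function.update (Function.update R K.x []) K.kid (v[u.length]'(by omega) :: w) K.kid =
      v[u.length]'(by omega) :: w := by simp
  have h2 := Runs.pop_cons (f := fun _ => skip) hk ((Runs.skip _).of_eq (R' :=
    Function.update (Function.update R K.x []) K.kid w) (by funext r; cases r <;> simp) le_rfl)
  exact (hloop.seq h2).of_eq rfl (by omega)

/-- Action of the petal emission on a literal of `t`: keep it on `kid` unless it belongs to the
heart. [folklore] -/
def petalLitAct : Prog :=
  memXC ;; pop K.fl fun o => match o with
    | some _ => dropLit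
    | none => clear K.x

/-- `petalEmit`: with `c = cbody t` and `h = cbody H`, append to `kid` the (reversed) clause
word of the petal `t.filter (∉ H)`; `c` ends empty, `h` is preserved. [folklore] -/
def petalEmit : Prog :=
  pour K.c K.y ;; pour K.y K.d ;; copyFwd K.h K.c K.y K.pt ;;
  push K.kid Γ'.bra ;; loop K.d (litPass K.kid K.x petalLitAct) ;; push K.kid Γ'.ket ;; clear K.c

/-- Cost of `petalEmit`. [folklore] -/
def cEmit (L kk : ℕ) : ℕ := 18 * ((L + 1) * kk) + (36 * (L + 1) * kk + 8 * L + 15) * kk + 9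

/-- **Specification of `petalEmit`.** [folklore] -/
theorem runs_petalEmit (t H : List Lit) (L kk : ℕ) (hLt : ∀ l ∈ t, (litBody l).length ≤ L)
    (hkt : t.length ≤ kk) (hLH : ∀ l ∈ H, (litBody l).length ≤ L) (hkH : H.length ≤ kk)
    (T : Store) (hc : T K.c = cbody t) (hh : T K.h = cbody H) (hd : T K.d = []) (hpt : T K.pt = [])
    (hT : Clean T) :
    Runs petalEmit T (Function.update (Function.update T K.c []) K.kid
      ((Γ'.bra :: cbody (t.filter fun l => l ∉ H) ++ [Γ'.ket]).reverse ++ T K.kid)) (cEmit L kk) := by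
  obtain ⟨hx, hx2, hy, hne, hfl, hfl2, hc2, hd2⟩ := hT
  unfold petalEmit
  set W := (L + 1) * kk with hW
  have hWt : (cbody t).length ≤ W :=
    (length_cbody_le hLt).trans (by rw [hW]; exact Nat.mul_le_mul_left _ hkt)
  have hWH : (cbody H).length ≤ W :=
    (length_cbody_le hLH).trans (by rw [hW]; exact Nat.mul_le_mul_left _ hkH)
  -- move `t` to `d`
  have e1 := runs_pour (a := K.c) (b := K.y) (by decide) T
  rw [hc, hy, List.append_nil] at e1
  set T₁ := Function.update (Function.update T K.c []) K.y (cbody t).reverse with hT₁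
  have e2 := runs_pour (a := K.y) (b := K.d) (by decide) T₁
  have hT₁y : T₁ K.y = (cbody t).reverse := by simp [hT₁]
  have hT₁d : T₁ K.d = [] := by simp [hT₁, hd]
  rw [hT₁y, hT₁d, List.length_reverse, List.reverse_reverse, List.append_nil] at e2
  set T₂ := Function.update (Function.update T₁ K.y []) K.d (cbody t) with hT₂
  -- a copy of the heart in `c`
  have e3 := runs_copyFwd (a := K.h) (b := K.c) (t₁ := K.y) (t₂ := K.pt) (by decide) (by decide)
    (by decide) (by decide) (by decide) (by decide) T₂ (by simp [hT₂]) (by simp [hT₂, hT₁, hpt])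
  have hT₂h : T₂ K.h = cbody H := by simp [hT₂, hT₁, hh]
  have hT₂c : T₂ K.c = [] := by simp [hT₂, hT₁]
  rw [hT₂h, hT₂c, List.append_nil] at e3
  set T₃ := Function.update T₂ K.c (cbody H) with hT₃
  -- open the clause on `kid`
  have e4 := Runs.push K.kid Γ'.bra T₃
  set T₄ := Function.update T₃ K.kid (Γ'.bra :: T₃ K.kid) with hT₄
  have hT₄v : ∀ r, r ≠ K.d → r ≠ K.kid → r ≠ K.c → r ≠ K.y → T₄ r = T r := by
    intro r h1 h2 h3 h4
    simp [hT₄, hT₃, hT₂, hT₁, Function.update_of_ne h1, Function.update_of_ne h2,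
      Function.update_of_ne h3, Function.update_of_ne h4]
  have hT₄y : T₄ K.y = [] := by simp [hT₄, hT₃, hT₂]
  have hT₄c : T₄ K.c = cbody H := by simp [hT₄, hT₃]
  have hT₄kid : T₄ K.kid = Γ'.bra :: T K.kid := by simp [hT₄, hT₃, hT₂, hT₁]
  -- the filtering pass
  set St : List Lit → List Lit → Store := fun done rest =>
    Function.update (Function.update T₄ K.d (cbody rest)) K.kid
      ((cbody (done.filter fun l => l ∉ H)).reverse ++ Γ'.bra :: T K.kid) with hSt
  have hpass := runs_litPass (reg := K.d) (sv := K.kid) (ac := K.x) petalLitAct (by decide)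
    (by decide) (by decide) St t L (36 * (L + 1) * kk + 4 * L + 12)
    (fun done rest => by simp [hSt])
    (fun done rest => by
      simp only [hSt]
      rw [Function.update_of_ne (by decide), Function.update_of_ne (by decide),
        hT₄v K.x (by decide) (by decide) (by decide) (by decide), hx])
    (fun done l rest hfull hl => by
      unfold petalLitAct
      set P := litPre K.d K.kid K.x (St done (l :: rest)) l rest with hP
      have hPv : ∀ r, r ≠ K.d → r ≠ K.kid → r ≠ K.c → r ≠ K.y → r ≠ K.x → P r = T r := by
        intro r h1 h2 h3 h4 h5
        rw [hP, litPre, Function.update_of_ne h5, Function.update_of_ne h2,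
          Function.update_of_ne h1, hSt]
        simp only []
        rw [Function.update_of_ne h2, Function.update_of_ne h1, hT₄v r h1 h2 h3 h4]
      have hPc : P K.c = cbody H := by simp [hP, litPre, hSt, hT₄c]
      have hPy : P K.y = [] := by simp [hP, litPre, hSt, hT₄y]
      have hPx : P K.x = (litBody l).reverse := by
        simp only [hP, litPre]
        rw [Function.update_self]
        simp only [hSt]
        rw [Function.update_of_ne (by decide), Function.update_of_ne (by decide),
          hT₄v K.x (by decide) (by decide) (by decide) (by decide), hx, List.append_nil]
      have hPkid : P K.kid = (litBody l ++ [Γ'.comma]).reverse ++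
          ((cbody (done.filter fun l => l ∉ H)).reverse ++ Γ'.bra :: T K.kid) := by
        simp [hP, litPre, hSt]
      have f1 := runs_memXC l H L hl hLH P hPc hPx
        (by rw [hPv K.c2 (by decide) (by decide) (by decide) (by decide) (by decide), hc2]) hPy
        (by rw [hPv K.x2 (by decide) (by decide) (by decide) (by decide) (by decide), hx2])
        (by rw [hPv K.ne (by decide) (by decide) (by decide) (by decide) (by decide), hne])
        (by rw [hPv K.fl (by decide) (by decide) (by decide) (by decide) (by decide), hfl])
      have hPfl : P K.fl = [] := by
        rw [hPv K.fl (by decide) (by decide) (by decide) (by decide) (by decide), hfl]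
      set P₁ := Function.update P K.fl (flag (l ∈ H)) with hP₁
      have hq : Function.update P₁ K.fl [] = P := by
        rw [hP₁, Function.update_idem, ← hPfl, Function.update_eq_self]
      have hPx4 : T₄ K.x = [] := by rw [hT₄v K.x (by decide) (by decide) (by decide) (by decide), hx]
      have f2 : Runs (pop K.fl fun o => match o with
          | some _ => dropLit
          | none => clear K.x) P₁ (St (done ++ [l]) rest) (4 * L + 5) := by
        by_cases hlH : l ∈ H
        · have hk : P₁ K.fl = [Γ'.blank] := by simp [hP₁, flag, hlH]
          have g := runs_dropLit P (litBody l).reverse ((litBody l ++ [Γ'.comma]).reverse)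
            ((cbody (done.filter fun l => l ∉ H)).reverse ++ Γ'.bra :: T K.kid) hPx hPkid (by simp)
          rw [List.length_reverse, ← hq] at g
          refine (Runs.pop_cons hk (g.of_eq ?_ le_rfl)).mono (by omega)
          rw [hq, hP]
          simp only [litPre, hSt, List.filter_append, List.filter_cons, hlH, not_true,
            decide_false, List.filter_nil]
          funext r; cases r <;> simp [hPx4]
        · have hk : P₁ K.fl = [] := by simp [hP₁, flag, hlH]
          have hq' : P₁ = P := by rw [← hq, ← hk, Function.update_eq_self]
          rw [hq']
          have g := runs_clear K.x P
          rw [hPx, List.length_reverse] at g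
          refine (Runs.pop_nil hPfl g).of_eq ?_ (by omega)
          rw [hP]
          simp only [litPre, hSt, List.filter_append, List.filter_cons, hlH, not_false_eq_true,
            decide_true, List.filter_nil, cbody_append]
          funext r; cases r <;> simp [hPx4, cbody_cons]
      have := f1.seq f2
      refine this.mono ?_
      have : 36 * (L + 1) * H.length ≤ 36 * (L + 1) * kk := Nat.mul_le_mul_left _ hkH
      omega)
    t [] rfl hLt
  have hSt0 : St [] t = T₄ := by
    funext r; cases r <;> simp [hSt, hT₄, hT₃, hT₂, hT₁]
  rw [hSt0, List.nil_append] at hpass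
  set T₅ := St t [] with hT₅
  -- close the clause, drop the heart copy
  have e6 := Runs.push K.kid Γ'.ket T₅
  set T₆ := Function.update T₅ K.kid (Γ'.ket :: T₅ K.kid) with hT₆
  have e7 := runs_clear K.c T₆
  have hT₆c : T₆ K.c = cbody H := by simp [hT₆, hT₅, hSt, hT₄c]
  rw [hT₆c] at e7
  have := e1.seq (e2.seq (e3.seq (e4.seq (hpass.seq (e6.seq e7)))))
  refine this.of_eq ?_ ?_
  · rw [hT₆, hT₅]
    simp only [hSt, hT₄, hT₃, hT₂, hT₁]
    funext r; cases r <;> simp [hy, hd, cbody_nil]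
  · simp only [cEmit, ← hW]
    have : (4 * L + (36 * (L + 1) * kk + 4 * L + 12) + 3) * t.length ≤
        (36 * (L + 1) * kk + 8 * L + 15) * kk := by
      rw [show 4 * L + (36 * (L + 1) * kk + 4 * L + 12) + 3 = 36 * (L + 1) * kk + 8 * L + 15 by ring]
      exact Nat.mul_le_mul_left _ hkt
    omega

/-- Action of the petal pass on a clause `t`: if `|t| = j` and `H ⊆ t`, emit the petal `t ∖ H`.
[folklore] -/
def petalAct (j : ℕ) : Prog :=
  pourCount K.cacc K.c K.len ;;
  lenTest j (copyFwd K.h K.d K.y K.pt ;; subDC ;; clear K.d ;;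
    pop K.fl2 (fun o => match o with
      | some _ => skip
      | none => petalEmit)) ;;
  clear K.c

/-- `petalPass j`: push on the work-list the word of the petal child `M ++ petals` (closed by a
blank), keeping `acc = wFam M` and `h = cbody H`. [cite: ImpagliazzoPaturiZaneJCSS2001, §2 (line 5 of Reduce)] -/
def petalPass (j : ℕ) : Prog :=
  copy2 K.acc K.kid K.tmp ;; pour K.tmp K.acc ;; copyFwd K.acc K.mb K.y K.pt ;;
  loop K.mb (famPass K.j4 K.cacc (petalAct j)) ;; clear K.j4 ;; push K.kid Γ'.blank ;;
  pour K.kid K.wl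

/-- Cost of `petalAct`. [folklore] -/
def cPetalAct (L kk : ℕ) : ℕ :=
  42 * (L + 1) * (kk + 1) * kk + cEmit L kk + 18 * ((L + 1) * kk) + 6 * kk + 25

/-- Cost of `petalPass` over `n` clauses. [folklore] -/
def cPetal (L kk n : ℕ) : ℕ :=
  17 * (((L + 1) * kk + 2) * n) + 5 + ((4 * ((L + 1) * kk) + cPetalAct L kk + 6) * n + 1) +
    (2 * (((L + 1) * kk + 2) * n) + 1) + 1 + (3 * (((L + 1) * kk + 2) * (2 * n) + 1) + 1)

/-- The registers that the children construction needs empty. [folklore] -/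
structure KidClean (T : Store) : Prop where
  (mb : T K.mb = []) (j4 : T K.j4 = []) (cacc : T K.cacc = []) (c : T K.c = [])
  (len : T K.len = []) (d : T K.d = []) (pt : T K.pt = []) (kid : T K.kid = []) (tmp : T K.tmp = [])

/-- Literals of petals obey the literal bound. [folklore] -/
theorem litBound_petalsL {j : ℕ} {H : List Lit} {M : List (List Lit)} {L : ℕ}
    (hLM : ∀ t ∈ M, ∀ l ∈ t, (litBody l).length ≤ L) :
    ∀ p ∈ petalsL j H M, ∀ l ∈ p, (litBody l).length ≤ L := by
  intro p hp l hl
  simp only [petalsL, List.mem_map, List.mem_filter] at hp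
  obtain ⟨t, ⟨ht, -⟩, rfl⟩ := hp
  exact hLM t ht l (List.mem_of_mem_filter hl)

/-- Petals are not longer than the clause bound. [folklore] -/
theorem length_petalsL_le {j : ℕ} {H : List Lit} {M : List (List Lit)} {kk : ℕ}
    (hkM : ∀ t ∈ M, t.length ≤ kk) : ∀ p ∈ petalsL j H M, p.length ≤ kk := by
  intro p hp
  simp only [petalsL, List.mem_map, List.mem_filter] at hp
  obtain ⟨t, ⟨ht, -⟩, rfl⟩ := hp
  exact (List.length_filter_le _ _).trans (hkM t ht)

/-- There are at most as many petals as clauses. [folklore] -/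
theorem length_petalsL_le' (j : ℕ) (H : List Lit) (M : List (List Lit)) :
    (petalsL j H M).length ≤ M.length := by
  simp only [petalsL, List.length_map]; exact List.length_filter_le _ _

/-- **Specification of `petalAct`** on a clause `t` delivered (reversed) in `cacc`. [folklore] -/
theorem runs_petalAct (j : ℕ) (t H : List Lit) (L kk : ℕ) (hj : j ≤ kk)
    (hLt : ∀ l ∈ t, (litBody l).length ≤ L) (hkt : t.length ≤ kk)
    (hLH : ∀ l ∈ H, (litBody l).length ≤ L) (hkH : H.length ≤ kk) (P : Store)
    (hcacc : P K.cacc = (cbody t).reverse) (hc : P K.c = []) (hlen : P K.len = [])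
    (hh : P K.h = cbody H) (hd : P K.d = []) (hpt : P K.pt = []) (hP : Clean P) :
    Runs (petalAct j) P (Function.update (Function.update P K.cacc []) K.kid
      ((if selT j H t then (Γ'.bra :: cbody (t.filter fun l => l ∉ H) ++ [Γ'.ket]).reverse
        else []) ++ P K.kid)) (cPetalAct L kk) := by
  obtain ⟨hx, hx2, hy, hne, hfl, hfl2, hc2, hd2⟩ := hP
  unfold petalAct
  set W := (L + 1) * kk with hW
  have hWt : (cbody t).length ≤ W :=
    (length_cbody_le hLt).trans (by rw [hW]; exact Nat.mul_le_mul_left _ hkt)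
  have hWH : (cbody H).length ≤ W :=
    (length_cbody_le hLH).trans (by rw [hW]; exact Nat.mul_le_mul_left _ hkH)
  -- bring `t` in reading order, counting its literals
  have e1 := runs_pourCount (src := K.cacc) (dst := K.c) (cn := K.len) (by decide) (by decide)
    (by decide) P
  rw [hcacc, hc, hlen, List.length_reverse, List.reverse_reverse, List.append_nil,
    List.append_nil, List.count_reverse, count_comma_cbody] at e1
  set P₁ := Function.update (Function.update (Function.update P K.cacc []) K.c (cbody t)) K.len
    (unary t.length) with hP₁
  -- the size test, the inclusion test, the emission
  set P₃ := Function.update (Function.update (Function.update P₁ K.len []) K.c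
    (if selT j H t then [] else cbody t)) K.kid
    ((if selT j H t then (Γ'.bra :: cbody (t.filter fun l => l ∉ H) ++ [Γ'.ket]).reverse
      else []) ++ P K.kid) with hP₃
  have e2 : Runs (lenTest j (copyFwd K.h K.d K.y K.pt ;; subDC ;; clear K.d ;;
      pop K.fl2 (fun o => match o with
        | some _ => skip
        | none => petalEmit))) P₁ P₃
      (10 * W + 42 * (L + 1) * (kk + 1) * kk + 2 * W + cEmit L kk + 6 * kk + 18) := by
    by_cases htj : t.length = j
    · set Q := Function.update P₁ K.len [] with hQ
      have f1 := runs_copyFwd (a := K.h) (b := K.d) (t₁ := K.y) (t₂ := K.pt) (by decide)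
        (by decide) (by decide) (by decide) (by decide) (by decide) Q (by simp [hQ, hP₁, hy])
        (by simp [hQ, hP₁, hpt])
      have hQh : Q K.h = cbody H := by simp [hQ, hP₁, hh]
      have hQd : Q K.d = [] := by simp [hQ, hP₁, hd]
      rw [hQh, hQd, List.append_nil] at f1
      set Q₁ := Function.update Q K.d (cbody H) with hQ₁
      have f2 := runs_subDC H t L hLH hLt Q₁ (by simp [hQ₁]) (by simp [hQ₁, hQ, hP₁])
        (by simp [hQ₁, hQ, hP₁, hx]) (by simp [hQ₁, hQ, hP₁, hd2]) (by simp [hQ₁, hQ, hP₁, hfl2])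
        (by simp [hQ₁, hQ, hP₁, hc2]) (by simp [hQ₁, hQ, hP₁, hy]) (by simp [hQ₁, hQ, hP₁, hx2])
        (by simp [hQ₁, hQ, hP₁, hne]) (by simp [hQ₁, hQ, hP₁, hfl])
      set Q₂ := Function.update Q₁ K.fl2 (flag (¬ H ⊆ t)) with hQ₂
      have f3 := runs_clear K.d Q₂
      have hQ₂d : Q₂ K.d = cbody H := by simp [hQ₂, hQ₁]
      rw [hQ₂d] at f3
      set Q₃ := Function.update Q₂ K.d [] with hQ₃
      have hQ₃c : Q₃ K.c = cbody t := by simp [hQ₃, hQ₂, hQ₁, hQ, hP₁]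
      have hQ₃kid : Q₃ K.kid = P K.kid := by simp [hQ₃, hQ₂, hQ₁, hQ, hP₁]
      set Q₄ := Function.update (Function.update (Function.update Q₃ K.fl2 []) K.c
        (if H ⊆ t then [] else cbody t)) K.kid
        ((if H ⊆ t then (Γ'.bra :: cbody (t.filter fun l => l ∉ H) ++ [Γ'.ket]).reverse
          else []) ++ P K.kid) with hQ₄
      have f4 : Runs (pop K.fl2 fun o => match o with
          | some _ => skip
          | none => petalEmit) Q₃ Q₄ (cEmit L kk + 2) := by
        by_cases hHt : H ⊆ t
        · have hk : Q₃ K.fl2 = [] := by simp [hQ₃, hQ₂, flag, hHt]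
          have hcl : Clean Q₃ := ⟨by simp [hQ₃, hQ₂, hQ₁, hQ, hP₁, hx],
            by simp [hQ₃, hQ₂, hQ₁, hQ, hP₁, hx2], by simp [hQ₃, hQ₂, hQ₁, hQ, hP₁, hy],
            by simp [hQ₃, hQ₂, hQ₁, hQ, hP₁, hne], by simp [hQ₃, hQ₂, hQ₁, hQ, hP₁, hfl], hk,
            by simp [hQ₃, hQ₂, hQ₁, hQ, hP₁, hc2], by simp [hQ₃, hQ₂, hQ₁, hQ, hP₁, hd2]⟩
          have g := runs_petalEmit t H L kk hLt hkt hLH hkH Q₃ hQ₃c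
            (by simp [hQ₃, hQ₂, hQ₁, hQ, hP₁, hh]) (by simp [hQ₃])
            (by simp [hQ₃, hQ₂, hQ₁, hQ, hP₁, hpt]) hcl
          refine (Runs.pop_nil hk (g.of_eq ?_ le_rfl)).mono (by omega)
          rw [hQ₄, if_pos hHt, if_pos hHt, ← hQ₃kid]
          have : Function.update Q₃ K.fl2 [] = Q₃ := by rw [← hk]; exact Function.update_eq_self _ _
          rw [this]
        · have hk : Q₃ K.fl2 = [Γ'.blank] := by simp [hQ₃, hQ₂, flag, hHt]
          refine (Runs.pop_cons hk ((Runs.skip _).of_eq ?_ le_rfl)).mono (by omega)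
          rw [hQ₄, if_neg hHt, if_neg hHt, List.nil_append, ← hQ₃kid, ← hQ₃c]
          symm
          rw [Function.update_eq_self_iff.2 (by simp)]
          exact Function.update_eq_self_iff.2 (by simp)
      have hbody := f1.seq (f2.seq (f3.seq f4))
      have hP₁len : P₁ K.len = unary j := by simp [hP₁, htj]
      have hsel : selT j H t ↔ H ⊆ t := by simp [selT, htj]
      have hP₃len : P₃ K.len = [] := by simp [hP₃, hQ]
      refine (runs_lenTest_eq hP₁len (hbody.of_eq ?_ le_rfl) hP₃len).mono ?_
      · rw [hP₃, hQ₄, hQ₃, hQ₂, hQ₁, hQ]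
        by_cases hHt : H ⊆ t
        · simp only [if_pos (hsel.2 hHt), if_pos hHt]
          funext r; cases r <;> simp [hfl2, hd, hP₁]
        · simp only [if_neg (fun h => hHt (hsel.1 h)), if_neg hHt]
          funext r; cases r <;> simp [hfl2, hd, hP₁]
      · have h2 : 42 * (L + 1) * (t.length + 1) * H.length ≤ 42 * (L + 1) * (kk + 1) * kk := by
          have := Nat.mul_le_mul (Nat.mul_le_mul_left (42 * (L + 1)) (Nat.succ_le_succ hkt)) hkH
          simpa [Nat.mul_assoc] using this
        omega
    · have hP₁len : P₁ K.len = unary t.length := by simp [hP₁]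
      refine (runs_lenTest_ne (A := copyFwd K.h K.d K.y K.pt ;; subDC ;; clear K.d ;;
        pop K.fl2 (fun o => match o with
          | some _ => skip
          | none => petalEmit)) hP₁len htj).of_eq ?_ (by omega)
      have hns : ¬ selT j H t := fun h => htj h.1
      rw [hP₃, if_neg hns, if_neg hns, List.nil_append]
      funext r; cases r <;> simp [hP₁]
  -- clear `c`
  have e3 := runs_clear K.c P₃
  have hP₃c : (P₃ K.c).length ≤ W := by
    simp only [hP₃]; split <;> simp [hWt]
  have := e1.seq (e2.seq e3)
  refine this.of_eq ?_ ?_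
  · rw [hP₃, hP₁]
    by_cases hst : selT j H t
    · simp only [if_pos hst]
      funext r; cases r <;> simp [hc, hlen]
    · simp only [if_neg hst]
      funext r; cases r <;> simp [hc, hlen]
  · simp only [cPetalAct, ← hW]
    omega

/-- **Specification of `petalPass`.** [cite: ImpagliazzoPaturiZaneJCSS2001, §2 (line 5 of Reduce)] -/
theorem runs_petalPass (j : ℕ) (M : List (List Lit)) (H : List Lit) (L kk : ℕ) (hj : j ≤ kk)
    (hLM : ∀ t ∈ M, ∀ l ∈ t, (litBody l).length ≤ L) (hkM : ∀ t ∈ M, t.length ≤ kk)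
    (hLH : ∀ l ∈ H, (litBody l).length ≤ L) (hkH : H.length ≤ kk) (T : Store)
    (hacc : T K.acc = wFam M) (hh : T K.h = cbody H) (hT : Clean T) (hT' : KidClean T) :
    Runs (petalPass j) T (Function.update T K.wl
      (wFam (M ++ petalsL j H M) ++ Γ'.blank :: T K.wl)) (cPetal L kk M.length) := by
  obtain ⟨hx, hx2, hy, hne, hfl, hfl2, hc2, hd2⟩ := hT
  obtain ⟨hmb, hj4, hcacc, hc, hlen, hd, hpt, hkid, htmp⟩ := hT'
  unfold petalPass
  set W := (L + 1) * kk with hW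
  have hWM : ∀ t ∈ M, (cbody t).length ≤ W := fun t ht =>
    (length_cbody_le (hLM t ht)).trans (by rw [hW]; exact Nat.mul_le_mul_left _ (hkM t ht))
  have hlenM : (wFam M).length ≤ (W + 2) * M.length := length_wFam_le hWM
  -- `kid := (wFam M).reverse`, `acc` restored
  have e0 := runs_copy2 (a := K.acc) (b := K.kid) (c := K.tmp) (by decide) (by decide) (by decide) T
  simp only [hacc, hkid, htmp, List.append_nil] at e0
  set T₀ := Function.update (Function.update (Function.update T K.acc []) K.kid (wFam M).reverse)
    K.tmp (wFam M).reverse with hT₀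
  have e0' := runs_pour (a := K.tmp) (b := K.acc) (by decide) T₀
  have hT₀tmp : T₀ K.tmp = (wFam M).reverse := by simp [hT₀]
  have hT₀acc : T₀ K.acc = [] := by simp [hT₀]
  rw [hT₀tmp, hT₀acc, List.length_reverse, List.reverse_reverse, List.append_nil] at e0'
  set Tk := Function.update (Function.update T₀ K.tmp []) K.acc (wFam M) with hTk
  have hTkeq : Tk = Function.update T K.kid (wFam M).reverse := by
    funext r; cases r <;> simp [hTk, hT₀, hacc, htmp]
  -- the iteration copy
  have e1 := runs_copyFwd (a := K.acc) (b := K.mb) (t₁ := K.y) (t₂ := K.pt) (by decide)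
    (by decide) (by decide) (by decide) (by decide) (by decide) Tk
    (by rw [hTkeq]; simp [hy]) (by rw [hTkeq]; simp [hpt])
  rw [hTkeq] at e1 e0'
  simp only [ne_eq, reduceCtorEq, not_false_eq_true, Function.update_of_ne, hacc, hmb,
    List.append_nil] at e1
  set T₁ := Function.update (Function.update T K.kid (wFam M).reverse) K.mb (wFam M) with hT₁
  -- the petal pass
  set St : List (List Lit) → List (List Lit) → Store := fun done rest =>
    Function.update (Function.update (Function.update T K.mb (wFam rest)) K.j4
      (wFam done).reverse) K.kid ((wFam (petalsL j H done)).reverse ++ (wFam M).reverse) with hSt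
  have hpass := runs_famPass (reg := K.mb) (sv := K.j4) (ca := K.cacc) (petalAct j) (by decide)
    (by decide) (by decide) St M W (cPetalAct L kk)
    (fun done rest => by simp [hSt])
    (fun done rest => by simp [hSt, hcacc])
    (fun done t rest hfull htW => by
      have htmem : t ∈ M := by rw [← hfull]; simp
      set P := famPre K.mb K.j4 K.cacc (St done (t :: rest)) t rest with hP
      have hcl : Clean P := ⟨by simp [hP, famPre, hSt, hx], by simp [hP, famPre, hSt, hx2],
        by simp [hP, famPre, hSt, hy], by simp [hP, famPre, hSt, hne],
        by simp [hP, famPre, hSt, hfl], by simp [hP, famPre, hSt, hfl2],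
        by simp [hP, famPre, hSt, hc2], by simp [hP, famPre, hSt, hd2]⟩
      have g := runs_petalAct j t H L kk hj (hLM t htmem) (hkM t htmem) hLH hkH P
        (by simp [hP, famPre, hSt, hcacc]) (by simp [hP, famPre, hSt, hc])
        (by simp [hP, famPre, hSt, hlen]) (by simp [hP, famPre, hSt, hh])
        (by simp [hP, famPre, hSt, hd]) (by simp [hP, famPre, hSt, hpt]) hcl
      refine g.of_eq ?_ le_rfl
      rw [hP]
      simp only [famPre, hSt]
      by_cases hst : selT j H t
      · have : petalsL j H (done ++ [t]) = petalsL j H done ++ [t.filter fun l => l ∉ H] := by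
          simp [petalsL, List.filter_append, hst]
        rw [this, if_pos hst]
        funext r; cases r <;> simp [hcacc, wFam_append, wFam_cons]
      · have : petalsL j H (done ++ [t]) = petalsL j H done := by
          simp [petalsL, List.filter_append, hst]
        rw [this, if_neg hst]
        funext r; cases r <;> simp [hcacc, wFam_append, wFam_cons])
    M [] rfl hWM
  have hSt0 : St [] M = T₁ := by
    rw [hSt, hT₁]
    simp only [petalsL, List.filter_nil, List.map_nil, wFam_nil, List.reverse_nil,
      List.nil_append]
    funext r; cases r <;> simp [hj4]
  rw [hSt0, List.nil_append] at hpass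
  set T₂ := St M [] with hT₂
  -- clear the junk copy, close the family, push it on the work-list
  have e4 := runs_clear K.j4 T₂
  have hT₂j4 : T₂ K.j4 = (wFam M).reverse := by simp [hT₂, hSt]
  rw [hT₂j4, List.length_reverse] at e4
  set T₃ := Function.update T₂ K.j4 [] with hT₃
  have e5 := Runs.push K.kid Γ'.blank T₃
  set T₄ := Function.update T₃ K.kid (Γ'.blank :: T₃ K.kid) with hT₄
  have e6 := runs_pour (a := K.kid) (b := K.wl) (by decide) T₄
  have hT₄kid : T₄ K.kid = (wFam (M ++ petalsL j H M) ++ [Γ'.blank]).reverse := by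
    simp [hT₄, hT₃, hT₂, hSt, wFam_append]
  have hT₄wl : T₄ K.wl = T K.wl := by simp [hT₄, hT₃, hT₂, hSt]
  rw [hT₄kid, hT₄wl, List.length_reverse, List.reverse_reverse] at e6
  have := e0.seq (e0'.seq (e1.seq (hpass.seq (e4.seq (e5.seq e6)))))
  refine this.of_eq ?_ ?_
  · rw [hT₄, hT₃, hT₂]
    simp only [hSt]
    funext r; cases r <;> simp [hj4, hmb, hkid]
  · have hWP : ∀ p ∈ M ++ petalsL j H M, (cbody p).length ≤ W := by
      intro p hp
      rw [List.mem_append] at hp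
      rcases hp with hp | hp
      · exact hWM p hp
      · exact (length_cbody_le (litBound_petalsL hLM p hp)).trans
          (by rw [hW]; exact Nat.mul_le_mul_left _ (length_petalsL_le hkM p hp))
    have hlen2 : (wFam (M ++ petalsL j H M)).length ≤ (W + 2) * (2 * M.length) :=
      (length_wFam_le hWP).trans (Nat.mul_le_mul_left _ (by
        rw [List.length_append]; have := length_petalsL_le' j H M; omega))
    simp only [cPetal, ← hW, List.length_append, List.length_singleton]
    omega

/-! ### The heart child, both children, the leaf -/

/-- `heartKid`: push on the work-list the word of the heart child `M ++ [H]` (closed by a blank),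
keeping `acc = wFam M` and emptying `h`. [cite: ImpagliazzoPaturiZaneJCSS2001, §2 (line 5 of Reduce)] -/
def heartKid : Prog :=
  copy2 K.acc K.kid K.tmp ;; pour K.tmp K.acc ;; push K.kid Γ'.bra ;; pour K.h K.kid ;;
  push K.kid Γ'.ket ;; push K.kid Γ'.blank ;; pour K.kid K.wl

/-- Cost of `heartKid`. [folklore] -/
def cHeart (L kk n : ℕ) : ℕ :=
  7 * (((L + 1) * kk + 2) * n) + 3 * ((L + 1) * kk) +
    3 * (((L + 1) * kk + 2) * (n + 1) + 1) + 8

/-- **Specification of `heartKid`.** [cite: ImpagliazzoPaturiZaneJCSS2001, §2 (line 5 of Reduce)] -/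
theorem runs_heartKid (M : List (List Lit)) (H : List Lit) (L kk : ℕ)
    (hLM : ∀ t ∈ M, ∀ l ∈ t, (litBody l).length ≤ L) (hkM : ∀ t ∈ M, t.length ≤ kk)
    (hLH : ∀ l ∈ H, (litBody l).length ≤ L) (hkH : H.length ≤ kk) (T : Store)
    (hacc : T K.acc = wFam M) (hh : T K.h = cbody H) (hkid : T K.kid = []) (htmp : T K.tmp = []) :
    Runs heartKid T (Function.update (Function.update T K.h []) K.wl
      (wFam (M ++ [H]) ++ Γ'.blank :: T K.wl)) (cHeart L kk M.length) := by
  unfold heartKid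
  set W := (L + 1) * kk with hW
  have hWM : ∀ t ∈ M, (cbody t).length ≤ W := fun t ht =>
    (length_cbody_le (hLM t ht)).trans (by rw [hW]; exact Nat.mul_le_mul_left _ (hkM t ht))
  have hWH : (cbody H).length ≤ W :=
    (length_cbody_le hLH).trans (by rw [hW]; exact Nat.mul_le_mul_left _ hkH)
  have hlenM : (wFam M).length ≤ (W + 2) * M.length := length_wFam_le hWM
  have e0 := runs_copy2 (a := K.acc) (b := K.kid) (c := K.tmp) (by decide) (by decide) (by decide) T
  simp only [hacc, hkid, htmp, List.append_nil] at e0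
  set T₀ := Function.update (Function.update (Function.update T K.acc []) K.kid (wFam M).reverse)
    K.tmp (wFam M).reverse with hT₀
  have e1 := runs_pour (a := K.tmp) (b := K.acc) (by decide) T₀
  have hT₀tmp : T₀ K.tmp = (wFam M).reverse := by simp [hT₀]
  have hT₀acc : T₀ K.acc = [] := by simp [hT₀]
  rw [hT₀tmp, hT₀acc, List.length_reverse, List.reverse_reverse, List.append_nil] at e1
  have hTk : Function.update (Function.update T₀ K.tmp []) K.acc (wFam M) =
      Function.update T K.kid (wFam M).reverse := by
    funext r; cases r <;> simp [hT₀, hacc, htmp]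
  rw [hTk] at e1
  set T₁ := Function.update T K.kid (wFam M).reverse with hT₁
  have e2 := Runs.push K.kid Γ'.bra T₁
  set T₂ := Function.update T₁ K.kid (Γ'.bra :: T₁ K.kid) with hT₂
  have e3 := runs_pour (a := K.h) (b := K.kid) (by decide) T₂
  have hT₂h : T₂ K.h = cbody H := by simp [hT₂, hT₁, hh]
  have hT₂kid : T₂ K.kid = Γ'.bra :: (wFam M).reverse := by simp [hT₂, hT₁]
  rw [hT₂h, hT₂kid] at e3
  set T₃ := Function.update (Function.update T₂ K.h []) K.kid
    ((cbody H).reverse ++ Γ'.bra :: (wFam M).reverse) with hT₃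
  have e4 := Runs.push K.kid Γ'.ket T₃
  set T₄ := Function.update T₃ K.kid (Γ'.ket :: T₃ K.kid) with hT₄
  have e5 := Runs.push K.kid Γ'.blank T₄
  set T₅ := Function.update T₄ K.kid (Γ'.blank :: T₄ K.kid) with hT₅
  have e6 := runs_pour (a := K.kid) (b := K.wl) (by decide) T₅
  have hT₅kid : T₅ K.kid = (wFam (M ++ [H]) ++ [Γ'.blank]).reverse := by
    simp [hT₅, hT₄, hT₃, wFam_append, wFam_cons]
  have hT₅wl : T₅ K.wl = T K.wl := by simp [hT₅, hT₄, hT₃, hT₂, hT₁]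
  rw [hT₅kid, hT₅wl, List.length_reverse, List.reverse_reverse] at e6
  have := e0.seq (e1.seq (e2.seq (e3.seq (e4.seq (e5.seq e6)))))
  refine this.of_eq ?_ ?_
  · rw [hT₅, hT₄, hT₃, hT₂, hT₁]
    funext r; cases r <;> simp [hkid]
  · have hWP : ∀ p ∈ M ++ [H], (cbody p).length ≤ W := by
      intro p hp
      rw [List.mem_append, List.mem_singleton] at hp
      rcases hp with hp | rfl
      · exact hWM p hp
      · exact hWH
    have hlen2 : (wFam (M ++ [H])).length ≤ (W + 2) * (M.length + 1) :=
      (length_wFam_le hWP).trans (by simp)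
    simp only [cHeart, ← hW, List.length_append, List.length_singleton]
    omega

/-- `buildChildren j`: push the petal child, then the heart child on top of it.
[cite: ImpagliazzoPaturiZaneJCSS2001, §2 (line 5 of Reduce)] -/
def buildChildren (j : ℕ) : Prog := petalPass j ;; heartKid

/-- Cost of `buildChildren`. [folklore] -/
def cKids (L kk n : ℕ) : ℕ := cPetal L kk n + cHeart L kk n

/-- **Specification of `buildChildren`**: the work-list receives the words of the heart child
`M ++ [H]` and, below it, of the petal child `M ++ petals`.
[cite: ImpagliazzoPaturiZaneJCSS2001, §2 (line 5 of Reduce)] -/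
theorem runs_buildChildren (j : ℕ) (M : List (List Lit)) (H : List Lit) (L kk : ℕ) (hj : j ≤ kk)
    (hLM : ∀ t ∈ M, ∀ l ∈ t, (litBody l).length ≤ L) (hkM : ∀ t ∈ M, t.length ≤ kk)
    (hLH : ∀ l ∈ H, (litBody l).length ≤ L) (hkH : H.length ≤ kk) (T : Store)
    (hacc : T K.acc = wFam M) (hh : T K.h = cbody H) (hT : Clean T) (hT' : KidClean T) :
    Runs (buildChildren j) T (Function.update (Function.update T K.h []) K.wl
      (wWL [M ++ [H], M ++ petalsL j H M] ++ T K.wl)) (cKids L kk M.length) := by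
  unfold buildChildren
  have e1 := runs_petalPass j M H L kk hj hLM hkM hLH hkH T hacc hh hT hT'
  set T₁ := Function.update T K.wl (wFam (M ++ petalsL j H M) ++ Γ'.blank :: T K.wl) with hT₁
  have e2 := runs_heartKid M H L kk hLM hkM hLH hkH T₁ (by simp [hT₁, hacc]) (by simp [hT₁, hh])
    (by simp [hT₁, hT'.kid]) (by simp [hT₁, hT'.tmp])
  refine (e1.seq e2).of_eq ?_ (by simp [cKids])
  rw [hT₁]
  funext r; cases r <;> simp [wWL_cons]

/-- `emitLeaf`: append to the (reversed) output `out2` the encoding of the leaf formula — the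
header `hdr2` (restored), the family word of `acc` (consumed) and a closing blank.
[cite: ImpagliazzoPaturiZaneJCSS2001, §2 (line 5 of Reduce, the output)] -/
def emitLeaf : Prog :=
  loop K.hdr2 (fun a => push K.out2 a ;; push K.hdr a) ;; pour K.hdr K.hdr2 ;;
  loop K.acc (fun a => push K.out2 a) ;; push K.out2 Γ'.blank

/-- **Specification of `emitLeaf`.** [folklore] -/
theorem runs_emitLeaf (T : Store) (hhdr : T K.hdr = []) :
    Runs emitLeaf T (Function.update (Function.update T K.acc []) K.out2
      ((T K.hdr2 ++ T K.acc ++ [Γ'.blank]).reverse ++ T K.out2))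
      (7 * (T K.hdr2).length + 3 * (T K.acc).length + 4) := by
  unfold emitLeaf
  have e1 := runs_copy2 (a := K.hdr2) (b := K.out2) (c := K.hdr) (by decide) (by decide) (by decide) T
  rw [hhdr, List.append_nil] at e1
  set T₁ := Function.update (Function.update (Function.update T K.hdr2 []) K.out2
    ((T K.hdr2).reverse ++ T K.out2)) K.hdr (T K.hdr2).reverse with hT₁
  have e2 := runs_pour (a := K.hdr) (b := K.hdr2) (by decide) T₁
  have hT₁hdr : T₁ K.hdr = (T K.hdr2).reverse := by simp [hT₁]
  have hT₁hdr2 : T₁ K.hdr2 = [] := by simp [hT₁]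
  rw [hT₁hdr, hT₁hdr2, List.length_reverse, List.reverse_reverse, List.append_nil] at e2
  set T₂ := Function.update (Function.update T₁ K.hdr []) K.hdr2 (T K.hdr2) with hT₂
  have e3 := runs_pour (a := K.acc) (b := K.out2) (by decide) T₂
  have hT₂acc : T₂ K.acc = T K.acc := by simp [hT₂, hT₁]
  have hT₂out2 : T₂ K.out2 = (T K.hdr2).reverse ++ T K.out2 := by simp [hT₂, hT₁]
  rw [hT₂acc, hT₂out2] at e3
  set T₃ := Function.update (Function.update T₂ K.acc []) K.out2
    ((T K.acc).reverse ++ ((T K.hdr2).reverse ++ T K.out2)) with hT₃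
  have e4 := Runs.push K.out2 Γ'.blank T₃
  have := e1.seq (e2.seq (e3.seq e4))
  refine this.of_eq ?_ (by omega)
  rw [hT₃, hT₂, hT₁]
  funext r; cases r <;> simp [hhdr]

/-! ### The scan: masks, clauses, levels -/

/-- The number of clauses of size `j` containing `H`. [folklore] -/
def cntT (j : ℕ) (H : List Lit) (M : List (List Lit)) : ℕ := M.countP (selT j H)

/-- The first mask (in the enumeration order) whose picked heart is contained in at least `θi`
clauses of size `j`, as that heart. [cite: ImpagliazzoPaturiZaneJCSS2001, §2 (line 4 of Reduce)] -/
def firstMask (θi : ℕ) (M : List (List Lit)) (j : ℕ) (s : List Lit) : List (List Bool) → Option (List Lit)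
  | [] => none
  | μ :: μs => if θi ≤ cntT j (pick μ s) M then some (pick μ s) else firstMask θi M j s μs

/-- The outcome of the masks loop at one clause: nothing unless the clause has size `j`.
[cite: ImpagliazzoPaturiZaneJCSS2001, §2 (line 4 of Reduce)] -/
def firstAt (θi : ℕ) (M : List (List Lit)) (j h : ℕ) (s : List Lit) : Option (List Lit) :=
  if s.length = j then firstMask θi M j s (masks j h) else none

/-- The first clause of size `j` (in the order of the list) having a mask that succeeds, as the
corresponding heart. [cite: ImpagliazzoPaturiZaneJCSS2001, §2 (line 4 of Reduce)] -/
def findS (θi : ℕ) (M : List (List Lit)) (j h : ℕ) : List (List Lit) → Option (List Lit)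
  | [] => none
  | s :: ss =>
    match firstAt θi M j h s with
    | some H => some H
    | none => findS θi M j h ss

/-- `findS` after a successful prefix. [folklore] -/
theorem findS_append_of_some {θi : ℕ} {M : List (List Lit)} {j h : ℕ} :
    ∀ {d : List (List Lit)} (r : List (List Lit)) {H : List Lit}, findS θi M j h d = some H →
      findS θi M j h (d ++ r) = some H
  | [], r, H, hd => by simp [findS] at hd
  | s :: d, r, H, hd => by
    rw [List.cons_append, findS]
    rw [findS] at hd
    cases hq : firstAt θi M j h s with
    | some H' => simp only [hq] at hd ⊢; exact hd
    | none => simp only [hq] at hd ⊢; exact findS_append_of_some r hd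

/-- `findS` after an unsuccessful prefix. [folklore] -/
theorem findS_append_of_none {θi : ℕ} {M : List (List Lit)} {j h : ℕ} :
    ∀ {d : List (List Lit)} (r : List (List Lit)), findS θi M j h d = none →
      findS θi M j h (d ++ r) = findS θi M j h r
  | [], r, _ => rfl
  | s :: d, r, hd => by
    rw [List.cons_append, findS]
    rw [findS] at hd
    cases hq : firstAt θi M j h s with
    | some H' => simp [hq] at hd
    | none => simp only [hq] at hd ⊢; exact findS_append_of_none r hd

/-- `findS` on a singleton. [folklore] -/
theorem findS_singleton (θi : ℕ) (M : List (List Lit)) (j h : ℕ) (s : List Lit) :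
    findS θi M j h [s] = firstAt θi M j h s := by
  rw [findS]
  cases firstAt θi M j h s <;> simp [findS]

/-- `guard P`: run `P` only if nothing has been found yet (`found` empty). [folklore] -/
def guard (P : Prog) : Prog :=
  ifTop K.found fun o => match o with
    | none => P
    | some _ => skip

/-- `tryMask θ j i μ`: extract the heart of the mask `μ` from the clause in `s`, count the clauses
of size `j` containing it, and if there are at least `θ i` of them record the find and build the
children. [cite: ImpagliazzoPaturiZaneJCSS2001, §2 (lines 4–5 of Reduce)] -/
def tryMask (θ : ℕ → ℕ) (j i : ℕ) (μ : List Bool) : Prog :=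
  extractH μ ;; countPass j ;;
  atLeast K.cnt (θ i) (push K.found Γ'.blank ;; buildChildren j) skip ;;
  clear K.cnt ;; clear K.h

/-- The masks loop at a clause: try the masks in order, stopping at the first success.
[cite: ImpagliazzoPaturiZaneJCSS2001, §2 (line 4 of Reduce)] -/
def masksLoop (θ : ℕ → ℕ) (j i : ℕ) : List (List Bool) → Prog
  | [] => skip
  | μ :: μs => guard (tryMask θ j i μ) ;; masksLoop θ j i μs

/-- Cost of `tryMask`. [folklore] -/
def cTry (L kk n θi : ℕ) : ℕ :=
  cExtract L kk kk + cCount L kk n + 2 * θi + cKids L kk n + 2 * n + 2 * ((L + 1) * kk) + 10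

/-- The registers that the scan needs empty at a clause boundary. [folklore] -/
structure ScanClean (T : Store) : Prop where
  (mask : T K.mask = []) (s2 : T K.s2 = []) (hr : T K.hr = []) (h : T K.h = [])
  (mb : T K.mb = []) (j4 : T K.j4 = []) (cacc : T K.cacc = []) (c : T K.c = [])
  (len : T K.len = []) (d : T K.d = []) (cnt : T K.cnt = []) (pt : T K.pt = [])
  (kid : T K.kid = []) (tmp : T K.tmp = [])

/-- The effect of a find on the store: the flag and the two children on the work-list. [folklore] -/
def afterFind (j : ℕ) (M : List (List Lit)) (T : Store) : Option (List Lit) → Store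
  | none => T
  | some H => Function.update (Function.update T K.found [Γ'.blank]) K.wl
      (wWL [M ++ [H], M ++ petalsL j H M] ++ T K.wl)

/-- `Clean` is about the eight scratch registers only. [folklore] -/
theorem Clean.of_update {T : Store} (h : Clean T) (r : K) (v : List Γ')
    (hr : r ≠ K.x ∧ r ≠ K.x2 ∧ r ≠ K.y ∧ r ≠ K.ne ∧ r ≠ K.fl ∧ r ≠ K.fl2 ∧ r ≠ K.c2 ∧ r ≠ K.d2) :
    Clean (Function.update T r v) := by
  obtain ⟨h1, h2, h3, h4, h5, h6, h7, h8⟩ := hr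
  exact ⟨by rw [Function.update_of_ne h1.symm, h.x], by rw [Function.update_of_ne h2.symm, h.x2],
    by rw [Function.update_of_ne h3.symm, h.y], by rw [Function.update_of_ne h4.symm, h.ne],
    by rw [Function.update_of_ne h5.symm, h.fl], by rw [Function.update_of_ne h6.symm, h.fl2],
    by rw [Function.update_of_ne h7.symm, h.c2], by rw [Function.update_of_ne h8.symm, h.d2]⟩

/-- **Specification of `tryMask`.** [cite: ImpagliazzoPaturiZaneJCSS2001, §2 (lines 4–5 of Reduce)] -/
theorem runs_tryMask (θ : ℕ → ℕ) (j i : ℕ) (μ : List Bool) (M : List (List Lit)) (s₀ : List Lit)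
    (L kk : ℕ) (hj : j ≤ kk) (hμ : μ.length ≤ kk)
    (hLM : ∀ t ∈ M, ∀ l ∈ t, (litBody l).length ≤ L) (hkM : ∀ t ∈ M, t.length ≤ kk)
    (hLs : ∀ l ∈ s₀, (litBody l).length ≤ L) (hks : s₀.length ≤ kk) (T : Store)
    (hacc : T K.acc = wFam M) (hs : T K.s = cbody s₀) (hfound : T K.found = [])
    (hT : Clean T) (hT' : ScanClean T) :
    Runs (tryMask θ j i μ) T
      (afterFind j M T (if θ i ≤ cntT j (pick μ s₀) M then some (pick μ s₀) else none))
      (cTry L kk M.length (θ i)) := by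
  obtain ⟨hmask, hs2, hhr, hh, hmb, hj4, hcacc, hc, hlen, hd, hcnt, hpt, hkid, htmp⟩ := hT'
  unfold tryMask
  set W := (L + 1) * kk with hW
  set H := pick μ s₀ with hH
  have hLH : ∀ l ∈ H, (litBody l).length ≤ L := litBound_pick hLs
  have hkH : H.length ≤ kk := (pick_sublist μ s₀).length_le.trans hks
  have hWH : (cbody H).length ≤ W :=
    (length_cbody_le hLH).trans (by rw [hW]; exact Nat.mul_le_mul_left _ hkH)
  -- the heart
  have e1 := runs_extractH μ s₀ L kk hLs hks T hs hmask hs2 hT.x hT.y hhr hh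
  set T₁ := Function.update T K.h (cbody H) with hT₁
  have hT₁c : Clean T₁ := hT.of_update _ _ (by decide)
  -- the count
  have e2 := runs_countPass j M H L kk hj hLM hkM hLH hkH T₁ (by simp [hT₁, hacc]) (by simp [hT₁])
    hT₁c ⟨by simp [hT₁, hmb], by simp [hT₁, hj4], by simp [hT₁, hcacc], by simp [hT₁, hc],
      by simp [hT₁, hlen], by simp [hT₁, hd], by simp [hT₁, hcnt], by simp [hT₁, hpt]⟩
  set N := cntT j H M with hN
  set T₂ := Function.update T₁ K.cnt (unary N) with hT₂
  have hT₂cnt : T₂ K.cnt = unary N := by simp [hT₂]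
  -- threshold, find, children
  set T₃ : Store := if θ i ≤ N then
      Function.update (Function.update (Function.update (Function.update T₂ K.found [Γ'.blank])
        K.h []) K.wl (wWL [M ++ [H], M ++ petalsL j H M] ++ T K.wl)) K.cnt (unary (N - θ i))
    else Function.update T₂ K.cnt [] with hT₃
  have e3 : Runs (atLeast K.cnt (θ i) (push K.found Γ'.blank ;; buildChildren j) skip) T₂ T₃
      (1 + cKids L kk M.length + 2 * θ i) := by
    by_cases hθ : θ i ≤ N
    · set Q := Function.update T₂ K.cnt ((T₂ K.cnt).drop (θ i)) with hQ
      have f1 := Runs.push K.found Γ'.blank Q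
      have hQfound : Q K.found = [] := by simp [hQ, hT₂, hT₁, hfound]
      rw [hQfound] at f1
      set Q₁ := Function.update Q K.found [Γ'.blank] with hQ₁
      have hQ₁v : ∀ r, r ≠ K.found → r ≠ K.cnt → r ≠ K.h → Q₁ r = T r := by
        intro r h1 h2 h3
        simp [hQ₁, hQ, hT₂, hT₁, Function.update_of_ne h1, Function.update_of_ne h2,
          Function.update_of_ne h3]
      have hQ₁c : Clean Q₁ := ((hT₁c.of_update _ _ (by decide)).of_update _ _ (by decide)).of_update
        _ _ (by decide)
      have f2 := runs_buildChildren j M H L kk hj hLM hkM hLH hkH Q₁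
        (by rw [hQ₁v K.acc (by decide) (by decide) (by decide), hacc]) (by simp [hQ₁, hQ, hT₂, hT₁])
        hQ₁c
        ⟨by rw [hQ₁v K.mb (by decide) (by decide) (by decide), hmb],
          by rw [hQ₁v K.j4 (by decide) (by decide) (by decide), hj4],
          by rw [hQ₁v K.cacc (by decide) (by decide) (by decide), hcacc],
          by rw [hQ₁v K.c (by decide) (by decide) (by decide), hc],
          by rw [hQ₁v K.len (by decide) (by decide) (by decide), hlen],
          by rw [hQ₁v K.d (by decide) (by decide) (by decide), hd],
          by rw [hQ₁v K.pt (by decide) (by decide) (by decide), hpt],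
          by rw [hQ₁v K.kid (by decide) (by decide) (by decide), hkid],
          by rw [hQ₁v K.tmp (by decide) (by decide) (by decide), htmp]⟩
      refine (Runs.atLeast_ge (B := skip) (by rw [hT₂cnt, length_unary]; exact hθ)
        ((f1.seq f2).of_eq ?_ le_rfl)).mono (by omega)
      rw [hT₃, if_pos hθ, hQ₁v K.wl (by decide) (by decide) (by decide), hQ₁, hQ, hT₂cnt]
      funext r; cases r <;> simp [unary, List.drop_replicate]
    · have f1 : Runs skip (Function.update T₂ K.cnt []) (Function.update T₂ K.cnt []) 0 :=
        Runs.skip _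
      refine (Runs.atLeast_lt (A := push K.found Γ'.blank ;; buildChildren j)
        (by rw [hT₂cnt, length_unary]; omega) f1).of_eq ?_ (by omega)
      rw [hT₃, if_neg hθ]
  -- clean up
  have e4 := runs_clear K.cnt T₃
  have hT₃cnt : (T₃ K.cnt).length ≤ N := by
    rw [hT₃]; split <;> simp
  have hNle : N ≤ M.length := List.countP_le_length
  set T₄ := Function.update T₃ K.cnt [] with hT₄
  have e5 := runs_clear K.h T₄
  have hT₄h : (T₄ K.h).length ≤ W := by
    rw [hT₄, Function.update_of_ne (by decide), hT₃]
    split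
    · simp
    · simp [hT₂, hT₁, hWH]
  have := e1.seq (e2.seq (e3.seq (e4.seq e5)))
  refine this.of_eq ?_ ?_
  · rw [hT₄, hT₃]
    by_cases hθ : θ i ≤ N
    · rw [if_pos hθ, if_pos hθ]
      simp only [afterFind, hT₂, hT₁]
      funext r; cases r <;> simp [hh, hcnt]
    · rw [if_neg hθ, if_neg hθ]
      simp only [afterFind, hT₂, hT₁]
      funext r; cases r <;> simp [hh, hcnt]
  · have hex : cExtract L kk μ.length ≤ cExtract L kk kk := by unfold cExtract; omega
    simp only [cTry, ← hW]
    omega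

/-- There are at most `2^j` masks of length `j`. [folklore] -/
theorem length_masks_le : ∀ (j h : ℕ), (masks j h).length ≤ 2 ^ j
  | 0, 0 => by simp [masks]
  | 0, _ + 1 => by simp [masks]
  | j + 1, 0 => by
    have := length_masks_le j 0
    simp only [masks, List.length_append, List.length_map, List.length_nil, Nat.pow_succ]
    omega
  | j + 1, h + 1 => by
    have h1 := length_masks_le j (h + 1)
    have h2 := length_masks_le j h
    simp only [masks, List.length_append, List.length_map, Nat.pow_succ]
    omega

/-- **The masks loop when something was found before**: nothing happens. [folklore] -/
theorem runs_masksLoop_found (θ : ℕ → ℕ) (j i : ℕ) (T : Store) {w : List Γ'}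
    (hfound : T K.found = Γ'.blank :: w) :
    ∀ μs : List (List Bool), Runs (masksLoop θ j i μs) T T (3 * μs.length)
  | [] => by simpa [masksLoop] using Runs.skip T
  | μ :: μs => by
    rw [masksLoop]
    have h1 : Runs (guard (tryMask θ j i μ)) T T 3 := Runs.ifTop_cons hfound (Runs.skip T)
    exact (h1.seq (runs_masksLoop_found θ j i T hfound μs)).of_eq rfl (by simp; omega)

/-- `afterFind` keeps everything but `found` and `wl`. [folklore] -/
theorem afterFind_apply_of_ne (j : ℕ) (M : List (List Lit)) (T : Store) (o : Option (List Lit))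
    {r : K} (h1 : r ≠ K.found) (h2 : r ≠ K.wl) : afterFind j M T o r = T r := by
  cases o with
  | none => rfl
  | some H => simp [afterFind, Function.update_of_ne h1, Function.update_of_ne h2]

/-- **The masks loop**: with nothing found before, its outcome is `firstMask`.
[cite: ImpagliazzoPaturiZaneJCSS2001, §2 (line 4 of Reduce)] -/
theorem runs_masksLoop (θ : ℕ → ℕ) (j i : ℕ) (M : List (List Lit)) (s₀ : List Lit) (L kk : ℕ)
    (hj : j ≤ kk) (hLM : ∀ t ∈ M, ∀ l ∈ t, (litBody l).length ≤ L) (hkM : ∀ t ∈ M, t.length ≤ kk)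
    (hLs : ∀ l ∈ s₀, (litBody l).length ≤ L) (hks : s₀.length ≤ kk) (T : Store)
    (hacc : T K.acc = wFam M) (hs : T K.s = cbody s₀) (hfound : T K.found = [])
    (hT : Clean T) (hT' : ScanClean T) :
    ∀ μs : List (List Bool), (∀ μ ∈ μs, μ.length ≤ kk) →
      Runs (masksLoop θ j i μs) T (afterFind j M T (firstMask (θ i) M j s₀ μs))
        ((cTry L kk M.length (θ i) + 3) * μs.length)
  | [], _ => by simpa [masksLoop, firstMask, afterFind] using Runs.skip T
  | μ :: μs, hμs => by
    rw [masksLoop]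
    have hμ := hμs μ List.mem_cons_self
    have h1 := runs_tryMask θ j i μ M s₀ L kk hj hμ hLM hkM hLs hks T hacc hs hfound hT hT'
    have h1' := Runs.ifTop_nil (f := fun o => match o with
      | none => tryMask θ j i μ
      | some _ => skip) hfound h1
    by_cases hθ : θ i ≤ cntT j (pick μ s₀) M
    · rw [if_pos hθ] at h1'
      have h2 := runs_masksLoop_found θ j i (afterFind j M T (some (pick μ s₀))) (w := [])
        (by simp [afterFind]) μs
      refine (h1'.seq h2).of_eq ?_ ?_
      · rw [firstMask, if_pos hθ]
      · simp only [List.length_cons]; nlinarith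
    · rw [if_neg hθ] at h1'
      have h2 := runs_masksLoop θ j i M s₀ L kk hj hLM hkM hLs hks T hacc hs hfound hT hT' μs
        (fun μ' h => hμs μ' (List.mem_cons_of_mem _ h))
      refine (h1'.seq h2).of_eq ?_ ?_
      · rw [firstMask, if_neg hθ]
      · simp only [List.length_cons]; nlinarith

/-- `processS θ j i`: the action of the scan of level `(j, i)` on a clause `s` delivered
(reversed) in `cacc`: bring it in reading order counting its literals, and if it has `j` of them
run the masks loop. [cite: ImpagliazzoPaturiZaneJCSS2001, §2 (lines 2–4 of Reduce)] -/
def processS (θ : ℕ → ℕ) (j i : ℕ) : Prog :=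
  pourCount K.cacc K.s K.len ;; lenTest j (masksLoop θ j i (masks j (j - i))) ;; clear K.s

/-- Cost of `processS`, `th` bounding the thresholds. [folklore] -/
def cProcS (L kk n th : ℕ) : ℕ :=
  6 * ((L + 1) * kk) + 2 ^ kk * (cTry L kk n th + 3) + 6 * kk + 12

/-- Monotonicity of `cTry` in the threshold. [folklore] -/
theorem cTry_mono (L kk n : ℕ) {a b : ℕ} (h : a ≤ b) : cTry L kk n a ≤ cTry L kk n b := by
  unfold cTry; omega

/-- **Specification of `processS`** on a clause `s₀` delivered (reversed) in `cacc`, from a store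
whose `found`/`wl` reflect an earlier outcome `o`. [cite: ImpagliazzoPaturiZaneJCSS2001, §2 (lines 2–4 of Reduce)] -/
theorem runs_processS (θ : ℕ → ℕ) (j i : ℕ) (M : List (List Lit)) (s₀ : List Lit) (L kk th : ℕ)
    (hj : j ≤ kk) (hth : θ i ≤ th)
    (hLM : ∀ t ∈ M, ∀ l ∈ t, (litBody l).length ≤ L) (hkM : ∀ t ∈ M, t.length ≤ kk)
    (hLs : ∀ l ∈ s₀, (litBody l).length ≤ L) (hks : s₀.length ≤ kk) (T : Store)
    (o : Option (List Lit)) (hacc : T K.acc = wFam M) (hcacc : T K.cacc = (cbody s₀).reverse)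
    (hs : T K.s = []) (hfound : T K.found = []) (hT : Clean T)
    (hmask : T K.mask = []) (hs2 : T K.s2 = []) (hhr : T K.hr = []) (hh : T K.h = [])
    (hmb : T K.mb = []) (hj4 : T K.j4 = []) (hc : T K.c = []) (hlen : T K.len = [])
    (hd : T K.d = []) (hcnt : T K.cnt = []) (hpt : T K.pt = []) (hkid : T K.kid = [])
    (htmp : T K.tmp = []) :
    Runs (processS θ j i) (afterFind j M T o)
      (afterFind j M (Function.update T K.cacc []) (o.or (firstAt (θ i) M j (j - i) s₀)))
      (cProcS L kk M.length th) := by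
  unfold processS
  set W := (L + 1) * kk with hW
  have hWs : (cbody s₀).length ≤ W :=
    (length_cbody_le hLs).trans (by rw [hW]; exact Nat.mul_le_mul_left _ hks)
  set A := afterFind j M T o with hA
  have hAv : ∀ r, r ≠ K.found → r ≠ K.wl → A r = T r := fun r h1 h2 =>
    afterFind_apply_of_ne j M T o h1 h2
  -- bring `s₀` in reading order, counting its literals
  have e1 := runs_pourCount (src := K.cacc) (dst := K.s) (cn := K.len) (by decide) (by decide)
    (by decide) A
  rw [hAv K.cacc (by decide) (by decide), hcacc, hAv K.s (by decide) (by decide), hs,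
    hAv K.len (by decide) (by decide), hlen, List.length_reverse, List.reverse_reverse,
    List.append_nil, List.append_nil, List.count_reverse, count_comma_cbody] at e1
  set A₁ := Function.update (Function.update (Function.update A K.cacc []) K.s (cbody s₀)) K.len
    (unary s₀.length) with hA₁
  -- the store on which the masks loop runs, as `afterFind` of a clean store
  set B : Store := Function.update (Function.update T K.cacc []) K.s (cbody s₀) with hB
  have hBA : Function.update A₁ K.len [] = afterFind j M B o := by
    rw [hA₁, hA, hB]
    cases o with
    | none => funext r; cases r <;> simp [afterFind, hlen]
    | some H => funext r; cases r <;> simp [afterFind, hlen]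
  have hBc : Clean B := (hT.of_update _ _ (by decide)).of_update _ _ (by decide)
  have hB' : ScanClean B := ⟨by simp [hB, hmask], by simp [hB, hs2], by simp [hB, hhr],
    by simp [hB, hh], by simp [hB, hmb], by simp [hB, hj4], by simp [hB], by simp [hB, hc],
    by simp [hB, hlen], by simp [hB, hd], by simp [hB, hcnt], by simp [hB, hpt], by simp [hB, hkid],
    by simp [hB, htmp]⟩
  set A₃ : Store := afterFind j M (Function.update T K.cacc [] |> fun T' =>
    Function.update T' K.s (cbody s₀)) (o.or (firstAt (θ i) M j (j - i) s₀)) with hA₃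
  have e2 : Runs (lenTest j (masksLoop θ j i (masks j (j - i)))) A₁ A₃
      (2 ^ kk * (cTry L kk M.length th + 3) + 2 * j + 2 * kk + 6) := by
    by_cases hsj : s₀.length = j
    · have hlenA : A₁ K.len = unary j := by simp [hA₁, hsj]
      have hμs : ∀ μ ∈ masks j (j - i), μ.length ≤ kk := fun μ hμ =>
        ((mem_masks_iff j (j - i) μ).1 hμ).1.le.trans hj
      have hml : (masks j (j - i)).length ≤ 2 ^ kk :=
        (length_masks_le j (j - i)).trans (Nat.pow_le_pow_right (by norm_num) hj)
      cases o with
      | some H' =>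
        -- already found: the loop is skipped
        have g := runs_masksLoop_found θ j i (afterFind j M B (some H')) (w := [])
          (by simp [afterFind]) (masks j (j - i))
        rw [← hBA] at g
        refine (runs_lenTest_eq hlenA g (by simp [hA₁])).of_eq ?_ ?_
        · rw [hA₃, hBA, hB]; try rfl
        · have := cTry_mono L kk M.length (Nat.zero_le th)
          nlinarith [Nat.zero_le (cTry L kk M.length th)]
      | none =>
        have g := runs_masksLoop θ j i M s₀ L kk hj hLM hkM hLs hks B (by simp [hB, hacc])
          (by simp [hB]) (by simp [hB, hfound]) hBc hB' (masks j (j - i)) hμs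
        simp only [afterFind] at hBA
        rw [← hBA] at g
        refine (runs_lenTest_eq hlenA g ?_).of_eq ?_ ?_
        · rw [afterFind_apply_of_ne _ _ _ _ (by decide) (by decide)]; simp
        · rw [hBA, hA₃, Option.none_or, firstAt, if_pos hsj]
        · have h1 := cTry_mono L kk M.length hth
          have : (cTry L kk M.length (θ i) + 3) * (masks j (j - i)).length ≤
              2 ^ kk * (cTry L kk M.length th + 3) := by
            calc (cTry L kk M.length (θ i) + 3) * (masks j (j - i)).length
                ≤ (cTry L kk M.length th + 3) * 2 ^ kk := Nat.mul_le_mul (by omega) hml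
              _ = 2 ^ kk * (cTry L kk M.length th + 3) := Nat.mul_comm _ _
          omega
    · have hlenA : A₁ K.len = unary s₀.length := by simp [hA₁]
      refine (runs_lenTest_ne (A := masksLoop θ j i (masks j (j - i))) hlenA hsj).of_eq ?_
        (by omega)
      rw [hA₃, hBA, hB, firstAt, if_neg hsj, Option.or_none]
  -- clear `s`
  have e3 := runs_clear K.s A₃
  have hA₃s : A₃ K.s = cbody s₀ := by
    rw [hA₃, afterFind_apply_of_ne _ _ _ _ (by decide) (by decide)]; simp
  rw [hA₃s] at e3
  have := e1.seq (e2.seq e3)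
  refine this.of_eq ?_ ?_
  · rw [hA₃]
    cases o.or (firstAt (θ i) M j (j - i) s₀) with
    | none => funext r; cases r <;> simp [afterFind, hs]
    | some H => funext r; cases r <;> simp [afterFind, hs]
  · simp only [cProcS, ← hW]
    omega

/-- `findS` of a list extended by one clause. [folklore] -/
theorem findS_append_singleton (θi : ℕ) (M : List (List Lit)) (j h : ℕ) (d : List (List Lit))
    (s : List Lit) : findS θi M j h (d ++ [s]) = (findS θi M j h d).or (firstAt θi M j h s) := by
  cases hd : findS θi M j h d with
  | some H => rw [findS_append_of_some [s] hd, Option.some_or]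
  | none => rw [findS_append_of_none [s] hd, findS_singleton, Option.none_or]

/-- Updates of other registers commute with `afterFind`. [folklore] -/
theorem update_afterFind (j : ℕ) (M : List (List Lit)) (T : Store) (o : Option (List Lit)) {r : K}
    (h1 : r ≠ K.found) (h2 : r ≠ K.wl) (v : List Γ') :
    Function.update (afterFind j M T o) r v = afterFind j M (Function.update T r v) o := by
  cases o with
  | none => rfl
  | some H =>
    simp only [afterFind]
    funext r'
    rcases eq_or_ne r r' with rfl | hne
    · simp [Function.update_of_ne h1, Function.update_of_ne h2]
    · rcases eq_or_ne K.wl r' with rfl | hw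
      · simp [Function.update_of_ne h2.symm]
      · rcases eq_or_ne K.found r' with rfl | hf
        · simp [Function.update_of_ne h1.symm]
        · simp [Function.update_of_ne hne.symm, Function.update_of_ne hw.symm,
            Function.update_of_ne hf.symm]

/-- The outcome of the scan of level `(j, i)`: the first clause (in the order of `M`) of size `j`
with a successful mask. [cite: ImpagliazzoPaturiZaneJCSS2001, §2 (lines 2–4 of Reduce)] -/
def findLevel (θ : ℕ → ℕ) (M : List (List Lit)) (j i : ℕ) : Option (List Lit) :=
  findS (θ i) M j (j - i) M

/-- `scanLevel θ j i`: run `processS` over a copy of the family.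
[cite: ImpagliazzoPaturiZaneJCSS2001, §2 (lines 2–4 of Reduce)] -/
def scanLevel (θ : ℕ → ℕ) (j i : ℕ) : Prog :=
  copyFwd K.acc K.ma K.y K.pt ;; loop K.ma (famPass K.j3 K.cacc (processS θ j i)) ;; clear K.j3

/-- Cost of `scanLevel`. [folklore] -/
def cLevel (L kk n th : ℕ) : ℕ :=
  12 * (((L + 1) * kk + 2) * n) + (4 * ((L + 1) * kk) + cProcS L kk n th + 6) * n + 5

/-- The registers that the scan of a level needs empty (besides the clean scratch registers and
`found`). [folklore] -/
structure LevelClean (T : Store) : Prop where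
  (ma : T K.ma = []) (j3 : T K.j3 = []) (cacc : T K.cacc = []) (s : T K.s = [])
  (mask : T K.mask = []) (s2 : T K.s2 = []) (hr : T K.hr = []) (h : T K.h = [])
  (mb : T K.mb = []) (j4 : T K.j4 = []) (c : T K.c = []) (len : T K.len = [])
  (d : T K.d = []) (cnt : T K.cnt = []) (pt : T K.pt = []) (kid : T K.kid = []) (tmp : T K.tmp = [])

/-- **Specification of `scanLevel`.** [cite: ImpagliazzoPaturiZaneJCSS2001, §2 (lines 2–4 of Reduce)] -/
theorem runs_scanLevel (θ : ℕ → ℕ) (j i : ℕ) (M : List (List Lit)) (L kk th : ℕ) (hj : j ≤ kk)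
    (hth : θ i ≤ th) (hLM : ∀ t ∈ M, ∀ l ∈ t, (litBody l).length ≤ L)
    (hkM : ∀ t ∈ M, t.length ≤ kk) (T : Store) (hacc : T K.acc = wFam M) (hfound : T K.found = [])
    (hT : Clean T) (hT' : LevelClean T) :
    Runs (scanLevel θ j i) T (afterFind j M T (findLevel θ M j i)) (cLevel L kk M.length th) := by
  obtain ⟨hma, hj3, hcacc, hs, hmask, hs2, hhr, hh, hmb, hj4, hc, hlen, hd, hcnt, hpt, hkid, htmp⟩ := hT'
  unfold scanLevel
  set W := (L + 1) * kk with hW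
  have hWM : ∀ t ∈ M, (cbody t).length ≤ W := fun t ht =>
    (length_cbody_le (hLM t ht)).trans (by rw [hW]; exact Nat.mul_le_mul_left _ (hkM t ht))
  have hlenM : (wFam M).length ≤ (W + 2) * M.length := length_wFam_le hWM
  -- the iteration copy
  have e0 := runs_copyFwd (a := K.acc) (b := K.ma) (t₁ := K.y) (t₂ := K.pt) (by decide)
    (by decide) (by decide) (by decide) (by decide) (by decide) T hT.y hpt
  rw [hacc, hma, List.append_nil] at e0
  set T₁ := Function.update T K.ma (wFam M) with hT₁
  -- the pass
  set St : List (List Lit) → List (List Lit) → Store := fun done rest =>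
    afterFind j M (Function.update (Function.update T K.ma (wFam rest)) K.j3 (wFam done).reverse)
      (findS (θ i) M j (j - i) done) with hSt
  have hpass := runs_famPass (reg := K.ma) (sv := K.j3) (ca := K.cacc) (processS θ j i) (by decide)
    (by decide) (by decide) St M W (cProcS L kk M.length th)
    (fun done rest => by
      simp only [hSt]; rw [afterFind_apply_of_ne _ _ _ _ (by decide) (by decide)]; simp)
    (fun done rest => by
      simp only [hSt]; rw [afterFind_apply_of_ne _ _ _ _ (by decide) (by decide)]; simp [hcacc])
    (fun done s₀ rest hfull hsW => by
      have hsmem : s₀ ∈ M := by rw [← hfull]; simp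
      set o := findS (θ i) M j (j - i) done with ho
      set Tb : Store := Function.update (Function.update (Function.update T K.ma (wFam rest)) K.j3
        (wFam (done ++ [s₀])).reverse) K.cacc (cbody s₀).reverse with hTb
      have hP : famPre K.ma K.j3 K.cacc (St done (s₀ :: rest)) s₀ rest = afterFind j M Tb o := by
        simp only [famPre, hSt, ← ho]
        rw [afterFind_apply_of_ne _ _ _ _ (by decide) (by decide),
          afterFind_apply_of_ne _ _ _ _ (by decide) (by decide),
          update_afterFind _ _ _ _ (by decide) (by decide),
          update_afterFind _ _ _ _ (by decide) (by decide),
          update_afterFind _ _ _ _ (by decide) (by decide), hTb]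
        congr 1
        funext r; cases r <;> simp [hcacc, wFam_append, wFam_cons]
      rw [hP]
      have hTbc : Clean Tb := ((hT.of_update _ _ (by decide)).of_update _ _ (by decide)).of_update
        _ _ (by decide)
      have g := runs_processS θ j i M s₀ L kk th hj hth hLM hkM (hLM s₀ hsmem) (hkM s₀ hsmem) Tb o
        (by simp [hTb, hacc]) (by simp [hTb]) (by simp [hTb, hs]) (by simp [hTb, hfound]) hTbc
        (by simp [hTb, hmask]) (by simp [hTb, hs2]) (by simp [hTb, hhr]) (by simp [hTb, hh])
        (by simp [hTb, hmb]) (by simp [hTb, hj4]) (by simp [hTb, hc]) (by simp [hTb, hlen])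
        (by simp [hTb, hd]) (by simp [hTb, hcnt]) (by simp [hTb, hpt]) (by simp [hTb, hkid])
        (by simp [hTb, htmp])
      refine g.of_eq ?_ le_rfl
      simp only [hSt, findS_append_singleton, ← ho, hTb]
      congr 1
      funext r; cases r <;> simp [hcacc])
    M [] rfl hWM
  have hSt0 : St [] M = T₁ := by
    simp only [hSt, findS, afterFind, hT₁]
    funext r; cases r <;> simp [hj3]
  rw [hSt0, List.nil_append] at hpass
  set T₂ := St M [] with hT₂
  have e3 := runs_clear K.j3 T₂
  have hT₂j3 : T₂ K.j3 = (wFam M).reverse := by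
    simp only [hT₂, hSt]; rw [afterFind_apply_of_ne _ _ _ _ (by decide) (by decide)]; simp
  rw [hT₂j3, List.length_reverse] at e3
  have := e0.seq (hpass.seq e3)
  refine this.of_eq ?_ ?_
  · rw [hT₂]
    simp only [hSt, findLevel]
    rw [update_afterFind _ _ _ _ (by decide) (by decide)]
    congr 1
    funext r; cases r <;> simp [hj3, hma]
  · simp only [cLevel, ← hW]
    omega

/-- The levels `(j, i)` of the scan in the loop order of `Reduce`: `j = 2, …, k`, and for each
`j`, `i = 1, …, j - 1`. [cite: ImpagliazzoPaturiZaneJCSS2001, §2 (lines 2–3 of Reduce)] -/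
def levels (k : ℕ) : List (ℕ × ℕ) :=
  (List.range' 2 (k - 1)).flatMap fun j => (List.range' 1 (j - 1)).map fun i => (j, i)

/-- Membership in `levels`. [folklore] -/
theorem mem_levels_iff {k j i : ℕ} : (j, i) ∈ levels k ↔ 2 ≤ j ∧ j ≤ k ∧ 1 ≤ i ∧ i < j := by
  simp only [levels, List.mem_flatMap, List.mem_range'_1, List.mem_map, Prod.mk.injEq]
  constructor
  · rintro ⟨j', ⟨hj1, hj2⟩, i', ⟨hi1, hi2⟩, rfl, rfl⟩; omega
  · rintro ⟨h1, h2, h3, h4⟩; exact ⟨j, ⟨h1, by omega⟩, i, ⟨h3, by omega⟩, rfl, rfl⟩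

/-- The number of levels is at most `k²`. [folklore] -/
theorem length_levels_le (k : ℕ) : (levels k).length ≤ k * k := by
  unfold levels
  rw [List.length_flatMap]
  have : ∀ j ∈ List.range' 2 (k - 1), ((List.range' 1 (j - 1)).map fun i => (j, i)).length ≤ k := by
    intro j hj
    rw [List.mem_range'_1] at hj
    simp; omega
  calc ((List.range' 2 (k - 1)).map fun j => ((List.range' 1 (j - 1)).map fun i => (j, i)).length).sum
      ≤ ((List.range' 2 (k - 1)).map fun _ => k).sum := List.sum_le_sum (by
        intro j hj; exact this j hj)
    _ = (k - 1) * k := by rw [List.map_const', List.sum_replicate, List.length_range', smul_eq_mul]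
    _ ≤ k * k := Nat.mul_le_mul_right _ (Nat.sub_le _ _)

/-- The outcome of the whole scan: the first level with a find, as `(j, H)`.
[cite: ImpagliazzoPaturiZaneJCSS2001, §2 (lines 2–4 of Reduce)] -/
def findBranch (θ : ℕ → ℕ) (M : List (List Lit)) : List (ℕ × ℕ) → Option (ℕ × List Lit)
  | [] => none
  | (j, i) :: ls =>
    match findLevel θ M j i with
    | some H => some (j, H)
    | none => findBranch θ M ls

/-- The effect of the scan on the store. [folklore] -/
def afterBranch (M : List (List Lit)) (T : Store) : Option (ℕ × List Lit) → Store
  | none => T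
  | some (j, H) => afterFind j M T (some H)

/-- `scanList θ ls`: scan the levels `ls` in order, stopping at the first find.
[cite: ImpagliazzoPaturiZaneJCSS2001, §2 (lines 2–4 of Reduce)] -/
def scanList (θ : ℕ → ℕ) : List (ℕ × ℕ) → Prog
  | [] => skip
  | (j, i) :: ls => guard (scanLevel θ j i) ;; scanList θ ls

/-- `scan θ k`: the scan of all levels. [cite: ImpagliazzoPaturiZaneJCSS2001, §2 (lines 2–4 of Reduce)] -/
def scan (θ : ℕ → ℕ) (k : ℕ) : Prog := scanList θ (levels k)

/-- **The level list when something was found before**: nothing happens. [folklore] -/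
theorem runs_scanList_found (θ : ℕ → ℕ) (T : Store) {w : List Γ'} (hfound : T K.found = Γ'.blank :: w) :
    ∀ ls : List (ℕ × ℕ), Runs (scanList θ ls) T T (3 * ls.length)
  | [] => by simpa [scanList] using Runs.skip T
  | (j, i) :: ls => by
    rw [scanList]
    have h1 : Runs (guard (scanLevel θ j i)) T T 3 := Runs.ifTop_cons hfound (Runs.skip T)
    exact (h1.seq (runs_scanList_found θ T hfound ls)).of_eq rfl (by simp; omega)

/-- **Specification of `scanList`.** [cite: ImpagliazzoPaturiZaneJCSS2001, §2 (lines 2–4 of Reduce)] -/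
theorem runs_scanList (θ : ℕ → ℕ) (M : List (List Lit)) (L kk th : ℕ)
    (hLM : ∀ t ∈ M, ∀ l ∈ t, (litBody l).length ≤ L) (hkM : ∀ t ∈ M, t.length ≤ kk)
    (T : Store) (hacc : T K.acc = wFam M) (hfound : T K.found = []) (hT : Clean T)
    (hT' : LevelClean T) :
    ∀ ls : List (ℕ × ℕ), (∀ p ∈ ls, p.1 ≤ kk ∧ θ p.2 ≤ th) →
      Runs (scanList θ ls) T (afterBranch M T (findBranch θ M ls))
        ((cLevel L kk M.length th + 3) * ls.length)
  | [], _ => by simpa [scanList, findBranch, afterBranch] using Runs.skip T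
  | (j, i) :: ls, hls => by
    rw [scanList]
    obtain ⟨hj, hth⟩ := hls (j, i) List.mem_cons_self
    have h1 := runs_scanLevel θ j i M L kk th hj hth hLM hkM T hacc hfound hT hT'
    have h1' := Runs.ifTop_nil (f := fun o => match o with
      | none => scanLevel θ j i
      | some _ => skip) hfound h1
    cases hfl : findLevel θ M j i with
    | some H =>
      rw [hfl] at h1'
      have h2 := runs_scanList_found θ (afterFind j M T (some H)) (w := []) (by simp [afterFind]) ls
      refine (h1'.seq h2).of_eq ?_ ?_
      · simp [findBranch, hfl, afterBranch]
      · simp only [List.length_cons]; nlinarith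
    | none =>
      rw [hfl] at h1'
      have h2 := runs_scanList θ M L kk th hLM hkM T hacc hfound hT hT' ls
        (fun p hp => hls p (List.mem_cons_of_mem _ hp))
      refine (h1'.seq h2).of_eq ?_ ?_
      · simp [findBranch, hfl]
      · simp only [List.length_cons]; nlinarith

/-- Cost of `scan`. [folklore] -/
def cScan (L kk n th : ℕ) : ℕ := (cLevel L kk n th + 3) * (kk * kk)

/-- **Specification of `scan`**: with nothing found yet, its outcome on the store is
`afterBranch` of `findBranch` over all levels in loop order.
[cite: ImpagliazzoPaturiZaneJCSS2001, §2 (lines 2–4 of Reduce)] -/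
theorem runs_scan (θ : ℕ → ℕ) (k : ℕ) (M : List (List Lit)) (L kk th : ℕ) (hk : k ≤ kk)
    (hth : ∀ i, i < k → θ i ≤ th)
    (hLM : ∀ t ∈ M, ∀ l ∈ t, (litBody l).length ≤ L) (hkM : ∀ t ∈ M, t.length ≤ kk)
    (T : Store) (hacc : T K.acc = wFam M) (hfound : T K.found = []) (hT : Clean T)
    (hT' : LevelClean T) :
    Runs (scan θ k) T (afterBranch M T (findBranch θ M (levels k))) (cScan L kk M.length th) := by
  unfold scan
  have h := runs_scanList θ M L kk th hLM hkM T hacc hfound hT hT' (levels k) (fun p hp => by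
    obtain ⟨j, i⟩ := p
    obtain ⟨h1, h2, h3, h4⟩ := mem_levels_iff.1 hp
    exact ⟨h2.trans hk, hth i (by omega)⟩)
  refine h.mono ?_
  unfold cScan
  exact Nat.mul_le_mul_left _ ((length_levels_le k).trans (Nat.mul_le_mul hk hk))

end Literature.Computability.FineGrained.Sparsifier
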